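import Summits.QuantumFields.YangMills.Theorems.TunedSequenceExists.Negative.Freezing
import Summits.QuantumFields.YangMills.Cruxes.IR.Lines.birth
import Literature.MathematicalPhysics.QuantumLattice.CentreSymmetryConfinementProofs
import Literature.MathematicalPhysics.QuantumLattice.LatticeGaugeDLRGibbsProofs
import Literature.MathematicalPhysics.QuantumLattice.LatticeGaugeDLRProofs
import Literature.MathematicalPhysics.QuantumLattice.LatticeGaugeDLRBoxKernels
import Literature.MathematicalPhysics.QuantumFieldTheory.LatticeGaugeAsymptotics
import Literature.MathematicalPhysics.QuantumFieldTheory.LatticeGaugeProofs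
import Literature.MathematicalPhysics.QuantumLattice.WilsonBlockHeatBathSemigroup
import Literature.MathematicalPhysics.QuantumLattice.WilsonBlockHeatBathMarkov3

/-!
# Crux-ideate seat ym-cruxidea-19354-8, GEN 5 — sketch for card `test-class-twist-row` (REV 2)
# The finite → compact non-transferring step, located and repaired: at FIXED MESH clause (i_T) of format T
# (registry `af-pincer-T`, sha16 0308f95ca6f6a115, (F1) = all measurable `[0,1]`-valued cell-0 cylinders as tests)
# FAILS for large `β` for EVERY compact `G` whose representation carries a central element as a scalar `c ≠ 1`
# (`SU(N)` fundamental: `c = e^{2πi/N}`; `ℤ_N`; `U(1)` charge `q` with `c = e^{iqθ}`), by a Peierls-free argument.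

Crux `stmt-QuantumFields-19354` = `BalabanLadder.IR`; registered skeleton `af-pincer-T` (stubs `stub_onsetT :
OnsetMixingTypical`, `stub_typCriterion`, `stub_afOnsetT`).  `TypShellCond` below is the VERBATIM registry text
(:165–:186; identical to GEN 3's copy of cplan rev 3 :911).

WHAT GEN 3 HAD: `not_typShellCond_z2` (ℤ₂ only, `sorry`, modulo two ℤ₂ Peierls inputs) built on the COLD DATUM `ζ = 1`.
WHY THAT DOES NOT TRANSFER TO COMPACT `G` (the lens' non-transferring step, −8 = «finite G (Adhikari–Cao) → compact G»):
for finite `G` the ground state is an atom of every Gibbs/torus state, so a typical class of positive mass contains the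
cold configuration and one may condition on it; for continuous `G` the pure-gauge orbit of `1` is a NULL set and a
cell-local `Typ c` (existential in format T) may exclude it — «typical» is a measure-class notion.  REPAIR (this file):
replace the cold datum by a `μ_{torus}`-TYPICAL RANDOM datum `ζ = torusLift V`, `V ∼ μ_{2S+1,β}` (supplied by the
format's own torus anchor (iii_T)), replace the open column by the column CLOSED THROUGH FROZEN SHELL CELLS into a
contractible `(b+1) × (2n+1)b` rectangle of the `(0,1)`-plane (a Polyakov closure around the time circle is useless:
centre symmetry gives it mean `0`), and average the kernel identity over `V` with the torus DLR equation.  No Peierls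
argument, no cluster expansion: fixed-volume Laplace (freezing) on ONE torus is the only physical input.

CHAIN (all at the standard mesh-`b` frame, `Y = rowCells n`, twist `τ_1` by a central `g₀` with `ρ g₀ = c • 1`):
* §0–§3  GEN 3, PROVED (unchanged): `τ_k` is a gauge transformation; kernel covariance; the format verbatim; clause
         (i_T) at the row ⇒ `‖∫ g dγ_row(ζ)‖ ≤ 4ε/‖1−c‖` for every charged cell-0 cylinder `g`, `‖g‖ ≤ 1`, and every
         datum `ζ` typical TOGETHER WITH `τ_1 ζ` off the row (`norm_integral_charged_le_of_clauseI`).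
* §4 (NEW) `col`, `staple`, `chargedTest ζ U = tr ρ(col U · staple ζ)/N` (data-adapted charged test: cylinder on
         `cellEdges (stdFrame b) 0`, measurable, `‖·‖ ≤ 1`, charge `c` — PROVED), `loopObs U = Re chargedTest U U` (the
         rectangle Wilson loop; continuous, cylinder on `loopEdges`, `|·| ≤ 1` — PROVED); PROPERNESS
         `∫ loopObs dγ_row(ζ) = ∫ Re chargedTest ζ dγ_row(ζ)` (PROVED, tree `integral_ymSpecification` + `glueWith`);
         torus DLR `E_μ[loopObs ∘ lift] = E_μ[V ↦ ∫ loopObs dγ_row(lift V)]` (PROVED instance of the tree's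
         `integral_torusLift_eq_integral_ymSpecification`, box geometry discharged);
         S1 `stub_twistedTypicalPairs` (PROVED; name kept): union bound + torus gauge invariance
         (`wilsonMeasure_map_gaugeTransform_holds`, `WilsonBlockHeatBath.torusLift_gaugeTransform`, band gauge
         `slabGauge 1 g₀ ∘ Torus.cRep`, `Torus.cRep_proj_of_mem_box`, cell-locality of `Typ`): the admissible twisted
         typical pairs `(lift V, τ_1 lift V)` have `μ`-mass `≥ 1 − 2·#cells·δ`;
         S2 `stub_torusLoopFreezing` (PROVED; name kept): fixed torus, `β → ∞`: `E_μ[loopObs ∘ lift] → 1` — the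
         tree's Laplace concentration `TunedSequenceExists.Negative.Freezing.tendsto_integral_wilsonMeasure`
         (continuous observable constant on the zero set of the Wilson action) + §4f⁺ (PROVED): zero action ⇒
         `Re tr ρ(U_p) = N` ⇒ `ρ(U_p) = 1` (unitary rigidity) ⇒ `U_p = 1` (`ρ` faithful) ⇒ the periodic lift is
         `(0,1)`-flat ⇒ `col · staple = 1` (planar lattice Stokes on `ℤ⁴`: two inductions on transports);
         COMPOSITION `not_typShellCond_fixedMesh` (PROVED; `#print axioms` = propext, Classical.choice, Quot.sound):
         `∀ b ≥ 1, n, 0 ≤ ε, 16ε < ‖1−c‖, 0 ≤ δ, 4·#windowCellsPlus(n)·δ < 1: ∃ β₀ ∀ β ≥ β₀, ¬ TypShellCond ρ β b n ε δ`.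
READING.  Not a refutation of `OnsetMixingTypical` (there `b = b(β)` may grow): it PROVES (unconditionally) that under
(F1) the typical onset `b⋆_T(β) → ∞` for every group with a charged centre element — format T's (i_T) has genuine
`Z(G)`-content at measure level, answering cruxidea-7 g4 §3 C-c («connected G ⇒ bulk absorbs every admissible twist»,
minimiser level) in the negative AT MEASURE LEVEL under (F1); consistent with cruxidea-2 g3's location theorem (the
witness region `Y = rowCells n` is a two-sided one-cell sandwich and `chargedTest` is face-to-face); VOID under the
gauge-invariant test class (F-GI, owner R33): GEN 3 `clauseIGI_twistPair` (PROVED) — the row then lives only in the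
chain rule's hybrid two-face tests (cruxidea-2 (C3)), not in (i_T).  The freezing input dies exactly when
`area × string tension ≈ (2n+1) b² σ(β) ≳ 1`, i.e. at `b ≈ ξ_G`: the obstruction is visible for `b ≪ ξ` and gone for
`b ≫ ξ` — the expected truth of `stub_onsetT` with `b⋆_T ≍ ξ_G`.

Count-neutral desk sketch (never landed as Theorems).  `lean check --json`: rc 0, errors [], warnings [], sorries = 0.
-/

set_option autoImplicit false

noncomputable section

open MeasureTheory Filter Topology
open Literature.MathematicalPhysics.QuantumLattice
open Literature.Probability.LatticeModels
open Summit.QuantumFields.YangMills.Cruxes.IR.Tempered (cellEdges windowCells regionEdges)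
open Summit.QuantumFields.YangMills.Cruxes.IR.ShellTempered (windowCellsPlus)

namespace Summit.QuantumFields.YangMills.Cruxes.IR.CruxIdea8g5

/-! ## §0 The layer twist is a gauge transformation -/

section Geometry

variable {G : Type} [Group G]

/-- The layer-`k` centre twist `τ_k`: multiply every vertical link `(x, 0)` with `x 0 = k` on the left by `g₀`
(GEN 2 `layerTwist`; Chatterjee's `τ` = tree `centreTransform` is `k = 0`). -/
def layerTwist (k : ℤ) (g₀ : G) (U : LGConfig 4 G) : LGConfig 4 G :=
  fun e => if e.2 = 0 ∧ e.1 0 = k then g₀ * U e else U e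

/-- `τ_0` is the tree's centre transform (definitional). -/
theorem layerTwist_zero (g₀ : G) : layerTwist (G := G) 0 g₀ = centreTransform g₀ := rfl

/-- The half-space gauge function `h_k(x) = g₀` if `x 0 ≤ k`, `= 1` above. -/
def slabGauge (k : ℤ) (g₀ : G) : Site 4 → G :=
  fun x => if x 0 ≤ k then g₀ else 1

/-- **PROVED (S). The centre twist is a gauge transformation:** `τ_k U = U^{h_k}` for central `g₀`
(vertical links at layer `k` pick up `g₀ · 1⁻¹`; every other link is conjugated by `g₀` or by `1`). -/
theorem layerTwist_eq_gaugeTransformZd {g₀ : G} (hg : g₀ ∈ Subgroup.center G) (k : ℤ) :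
    layerTwist k g₀ = gaugeTransformZd (slabGauge k g₀) := by
  have hconj : ∀ g : G, g₀ * g * g₀⁻¹ = g := fun g => by
    rw [← Subgroup.mem_center_iff.1 hg g, mul_inv_cancel_right]
  funext U e
  obtain ⟨x, i⟩ := e
  have h0 : ((x + Pi.single i (1 : ℤ) : Site 4)) 0 = x 0 + (if (0 : Fin 4) = i then 1 else 0) := by
    simp [Pi.single_apply]
  simp only [layerTwist, gaugeTransformZd, slabGauge, h0]
  by_cases hi : i = 0
  · subst hi
    by_cases hk : x 0 = k
    · have h1 : x 0 ≤ k := hk.le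
      have h2 : ¬ (x 0 + 1 ≤ k) := by omega
      simp [hk]
    · by_cases hle : x 0 ≤ k
      · have h2 : x 0 + 1 ≤ k := by omega
        simp [hk, hle, h2, hconj]
      · have h2 : ¬ (x 0 + 1 ≤ k) := by omega
        simp [hk, hle, h2]
  · have hi' : ¬ ((0 : Fin 4) = i) := fun h => hi h.symm
    by_cases hle : x 0 ≤ k
    · simp [hi, hi', hle, hconj]
    · simp [hi, hi', hle]

/-- **PROVED.** Every gauge-invariant data predicate (of ANY range) accepts `τ_k ζ` iff it accepts `ζ`. -/
theorem mem_layerTwist_iff {T : Set (LGConfig 4 G)}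
    (hT : ∀ (h : Site 4 → G) (U : LGConfig 4 G), gaugeTransformZd h U ∈ T ↔ U ∈ T)
    {g₀ : G} (hg : g₀ ∈ Subgroup.center G) (k : ℤ) (ζ : LGConfig 4 G) :
    layerTwist k g₀ ζ ∈ T ↔ ζ ∈ T := by
  rw [layerTwist_eq_gaugeTransformZd hg]
  exact hT _ _

/-- The standard mesh-`b` frame (GEN 2): cell-row `0` occupies the time layers `1, …, b`, widths exactly `b`. -/
def stdFrame (b : ℕ) : Fin 4 → ℤ → ℤ :=
  fun i j => if i = 0 then (b : ℤ) * j + 1 else (b : ℤ) * j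

/-- **PROVED.** The standard frame is admissible (`w i j + b ≤ w i (j+1) ≤ w i j + 2b`). -/
theorem stdFrame_admissible (b : ℕ) :
    ∀ i j, stdFrame b i j + ((b : ℕ) : ℤ) ≤ stdFrame b i (j + 1) ∧
      stdFrame b i (j + 1) ≤ stdFrame b i j + 2 * ((b : ℕ) : ℤ) := by
  intro i j
  have hb : (0 : ℤ) ≤ (b : ℤ) := Int.natCast_nonneg b
  unfold stdFrame
  split_ifs <;> constructor <;> nlinarith

/-- The window cells of row `0` (`y 0 = 0`): the SLAB-LIKE resampled region of the twist pair. -/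
def rowCells (n : ℕ) : Finset (Fin 4 → ℤ) :=
  (windowCells n).filter fun y => y 0 = 0

/-- **PROVED.** `rowCells n ⊆ windowCells n`. -/
theorem rowCells_subset (n : ℕ) : rowCells n ⊆ windowCells n := Finset.filter_subset _ _

/-- **PROVED.** `0 ∈ rowCells n`. -/
theorem zero_mem_rowCells (n : ℕ) : (0 : Fin 4 → ℤ) ∈ rowCells n := by
  refine Finset.mem_filter.2 ⟨?_, rfl⟩
  simp only [windowCells, Fintype.mem_piFinset, Pi.zero_apply, Finset.mem_Icc]
  intro _
  constructor <;> omega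

/-- The resampled region `Λ = ⋃_{y ∈ row 0} cellEdges` (tree `regionEdges`/`cellEdges` conventions). -/
def rowRegion (b n : ℕ) : Finset (ZdEdge 4) :=
  regionEdges (stdFrame b) (rowCells n)

/-- **PROVED (S). Agreement off the row:** for `1 ≤ k ≤ b` the twist `τ_k` changes no edge of a window cell off
row `0` — the (i_T) agreement hypothesis for the pair `(ζ, τ_k ζ)` at `Y = rowCells n`. -/
theorem layerTwist_agree_off_row {b n : ℕ} {k : ℤ} (hk : 1 ≤ k ∧ k ≤ (b : ℤ)) (g₀ : G) (ζ : LGConfig 4 G) :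
    ∀ c ∈ windowCellsPlus n, c ∉ rowCells n → c ∈ windowCells n →
      ∀ e ∈ cellEdges (stdFrame b) c, ζ e = layerTwist k g₀ ζ e := by
  intro c _ hcr hcw e he
  have hc0 : c 0 ≠ 0 := fun h => hcr (Finset.mem_filter.2 ⟨hcw, h⟩)
  have he1 : stdFrame b 0 (c 0) ≤ e.1 0 ∧ e.1 0 < stdFrame b 0 (c 0 + 1) := by
    have h := Fintype.mem_piFinset.1 (Finset.mem_product.1 he).1 0
    exact Finset.mem_Ico.1 h
  simp only [stdFrame, if_true] at he1
  unfold layerTwist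
  by_cases h : e.2 = 0 ∧ e.1 0 = k
  · exfalso
    have hb : (0 : ℤ) ≤ (b : ℤ) := Int.natCast_nonneg b
    rcases lt_or_gt_of_ne hc0 with hneg | hpos
    · have : (b : ℤ) * (c 0 + 1) ≤ 0 := mul_nonpos_of_nonneg_of_nonpos hb (by omega)
      omega
    · have : (b : ℤ) * 1 ≤ (b : ℤ) * c 0 := mul_le_mul_of_nonneg_left (by omega) hb
      omega
  · rw [if_neg h]

end Geometry

/-! ## §1 Kernel symmetry from gauge covariance; the charged identity; twist-blindness of invariant tests -/

section Symmetry

variable {G : Type} [Group G] [TopologicalSpace G] [IsTopologicalGroup G] [CompactSpace G]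
  [SecondCountableTopology G] [MeasurableSpace G] [BorelSpace G]
  {N : ℕ} (ρ : G →* Matrix (Fin N) (Fin N) ℂ)

omit [CompactSpace G] [SecondCountableTopology G] in
/-- `τ_k` is measurable (coordinatewise left multiplication). -/
theorem measurable_layerTwist (k : ℤ) (g₀ : G) : Measurable (layerTwist (G := G) k g₀) := by
  refine measurable_pi_lambda _ fun e => ?_
  by_cases he : e.2 = 0 ∧ e.1 0 = k
  · have : (fun U : LGConfig 4 G => layerTwist k g₀ U e) = fun U => g₀ * U e := by
      funext U; simp only [layerTwist, he, and_self, if_true]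
    rw [this]
    have h1 : Measurable (fun U : LGConfig 4 G => U e) := measurable_pi_apply e
    exact h1.const_mul g₀
  · have : (fun U : LGConfig 4 G => layerTwist k g₀ U e) = fun U => U e := by
      funext U; simp only [layerTwist, he, if_false]
    rw [this]; exact measurable_pi_apply e

/-- **PROVED (discharges GEN 2's sorry).** `τ_k` intertwines the Wilson DLR kernels:
`(γ_Λ(·|η)).map τ_k = γ_Λ(·|τ_k η)` for EVERY finite `Λ`, every central `g₀`, every real `β` — gauge covariance
of the specification (tree `ymSpecification_map_gaugeTransformZd_holds`) and §0. -/
theorem ymSpecification_map_layerTwist (hρ : Continuous ρ) {g₀ : G} (hg : g₀ ∈ Subgroup.center G)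
    (β : ℝ) (k : ℤ) (Λ : Finset (ZdEdge 4)) (η : LGConfig 4 G) :
    (ymSpecification ρ β Λ η).map (layerTwist k g₀) = ymSpecification ρ β Λ (layerTwist k g₀ η) := by
  rw [layerTwist_eq_gaugeTransformZd hg]
  exact ymSpecification_map_gaugeTransformZd_holds ρ hρ β Λ η (slabGauge k g₀)

/-- **PROVED.** For a measurable observable of charge `c` under `τ_k`, `∫ g dγ_Λ(τ_k η) = c · ∫ g dγ_Λ(η)`. -/
theorem integral_charged_layerTwist (hρ : Continuous ρ) {g₀ : G} (hg : g₀ ∈ Subgroup.center G)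
    (β : ℝ) (k : ℤ) (Λ : Finset (ZdEdge 4)) (η : LGConfig 4 G) {c : ℂ} {g : LGConfig 4 G → ℂ}
    (hgm : Measurable g) (hcharged : ∀ U, g (layerTwist k g₀ U) = c * g U) :
    ∫ U, g U ∂(ymSpecification ρ β Λ (layerTwist k g₀ η)) = c * ∫ U, g U ∂(ymSpecification ρ β Λ η) := by
  rw [← ymSpecification_map_layerTwist ρ hρ hg β k Λ η,
    integral_map (measurable_layerTwist k g₀).aemeasurable hgm.aestronglyMeasurable]
  simp_rw [hcharged]
  exact integral_const_mul c _

/-- **PROVED. Twist-blindness of gauge-invariant tests:** `∫ f dγ_Λ(τ_k η) = ∫ f dγ_Λ(η)` whenever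
`IsZdGaugeInvariant f` — the centre-twist row VANISHES on the gauge-invariant test class, for every group. -/
theorem integral_layerTwist_eq_of_gaugeInvariant (hρ : Continuous ρ) {g₀ : G} (hg : g₀ ∈ Subgroup.center G)
    (β : ℝ) (k : ℤ) (Λ : Finset (ZdEdge 4)) (η : LGConfig 4 G) {f : LGConfig 4 G → ℝ}
    (hfm : Measurable f) (hfi : IsZdGaugeInvariant f) :
    ∫ U, f U ∂(ymSpecification ρ β Λ (layerTwist k g₀ η)) = ∫ U, f U ∂(ymSpecification ρ β Λ η) := by
  rw [← ymSpecification_map_layerTwist ρ hρ hg β k Λ η,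
    integral_map (measurable_layerTwist k g₀).aemeasurable hfm.aestronglyMeasurable]
  simp only [layerTwist_eq_gaugeTransformZd hg, hfi (slabGauge k g₀)]

end Symmetry

/-! ## §2 The hedge format, verbatim, and its clause (i_T) isolated -/

/-- `M(n) = (4n+3)⁴ − (4n+1)⁴` (cplan `shellCount`, verbatim). -/
def shellCount (n : ℕ) : ℝ := ((((4 * n + 3) ^ 4 - (4 * n + 1) ^ 4 : ℕ)) : ℝ)

section Format

open Literature.MathematicalPhysics.QuantumFieldTheory (wilsonMeasure GaugeConfig)

variable {G : Type} [Group G] [TopologicalSpace G] [IsTopologicalGroup G] [CompactSpace G]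
  [MeasurableSpace G] [BorelSpace G]

/-- **The hedge format T, v0 — VERBATIM COPY of `ym-cplan-19354-af-pincer/line-af-pincer.lean` rev 3 :911
(sha16 3cf63dcaa2a1900d; not yet a tree module, hence the copy).**  (i_T) sub-region mixing among typical, agreeing
data; (ii_T) hereditary joint kernel rarity; (iii_T) torus anchor; `Typ` existential, measurable, CELL-LOCAL. -/
def TypShellCond {N : ℕ} (ρ : G →* Matrix (Fin N) (Fin N) ℂ) (β : ℝ) (b n : ℕ) (ε δ : ℝ) : Prop :=
  ∀ w : Fin 4 → ℤ → ℤ, (∀ i j, w i j + ((b : ℕ) : ℤ) ≤ w i (j + 1) ∧ w i (j + 1) ≤ w i j + 2 * ((b : ℕ) : ℤ)) →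
    ∃ Typ : (Fin 4 → ℤ) → Set (LGConfig 4 G),
      (∀ c, MeasurableSet (Typ c)) ∧ (∀ c, DependsOn (fun σ : LGConfig 4 G => σ ∈ Typ c) ↑(cellEdges w c)) ∧
      (∀ Y : Finset (Fin 4 → ℤ), Y ⊆ windowCells n → (0 : Fin 4 → ℤ) ∈ Y →
        ∀ σ σ' : LGConfig 4 G,
          (∀ c ∈ windowCellsPlus n, c ∉ Y → σ ∈ Typ c ∧ σ' ∈ Typ c) →
          (∀ c ∈ windowCellsPlus n, c ∉ Y → c ∈ windowCells n → ∀ e ∈ cellEdges w c, σ e = σ' e) →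
          ∀ f : LGConfig 4 G → ℝ, IsCylinder f (cellEdges w 0) → Measurable f → (∀ U, 0 ≤ f U ∧ f U ≤ 1) →
            |(∫ U, f U ∂(ymSpecification ρ β (regionEdges w Y) σ)) -
              ∫ U, f U ∂(ymSpecification ρ β (regionEdges w Y) σ')| ≤ ε) ∧
      (∀ F F' : Finset (Fin 4 → ℤ), F ⊆ F' → F.Nonempty → ∀ ζ : LGConfig 4 G,
        (∀ c' : Fin 4 → ℤ, c' ∉ F' → (∃ c ∈ F', ∀ i, |c' i - c i| ≤ 1) → ζ ∈ Typ c') →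
          (ymSpecification ρ β (regionEdges w F') ζ) {σ : LGConfig 4 G | ∀ c ∈ F, σ ∉ Typ c} ≤
            ENNReal.ofReal (δ ^ F.card)) ∧
      (∀ S : ℕ, 4 * b ≤ 2 * S + 1 → ∀ F : Finset (Fin 4 → ℤ), F.Nonempty →
        (∀ c ∈ F, ∀ i, -(S : ℤ) ≤ w i (c i) ∧ w i (c i + 1) ≤ (S : ℤ) + 1) →
          (wilsonMeasure (d := 4) (L := 2 * S + 1) ρ β)
              {V : GaugeConfig 4 (2 * S + 1) G | ∀ c ∈ F, torusLift (2 * S + 1) V ∉ Typ c} ≤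
            ENNReal.ofReal (δ ^ F.card))

/-- **Clause (i_T) isolated** at a frame `w` and a typical class `Typ` (verbatim third conjunct of `TypShellCond`). -/
def ClauseI {N : ℕ} (ρ : G →* Matrix (Fin N) (Fin N) ℂ) (β : ℝ) (w : Fin 4 → ℤ → ℤ) (n : ℕ) (ε : ℝ)
    (Typ : (Fin 4 → ℤ) → Set (LGConfig 4 G)) : Prop :=
  ∀ Y : Finset (Fin 4 → ℤ), Y ⊆ windowCells n → (0 : Fin 4 → ℤ) ∈ Y →
    ∀ σ σ' : LGConfig 4 G,
      (∀ c ∈ windowCellsPlus n, c ∉ Y → σ ∈ Typ c ∧ σ' ∈ Typ c) →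
      (∀ c ∈ windowCellsPlus n, c ∉ Y → c ∈ windowCells n → ∀ e ∈ cellEdges w c, σ e = σ' e) →
      ∀ f : LGConfig 4 G → ℝ, IsCylinder f (cellEdges w 0) → Measurable f → (∀ U, 0 ≤ f U ∧ f U ≤ 1) →
        |(∫ U, f U ∂(ymSpecification ρ β (regionEdges w Y) σ)) -
          ∫ U, f U ∂(ymSpecification ρ β (regionEdges w Y) σ')| ≤ ε

/-- **PROVED (definitional).** The format hands out, at the standard frame, a measurable cell-local class satisfying
(i_T) (and (ii_T), (iii_T), dropped here except the single-cell torus anchor used in §4). -/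
theorem clauseI_of_typShellCond {N : ℕ} {ρ : G →* Matrix (Fin N) (Fin N) ℂ} {β : ℝ} {b n : ℕ} {ε δ : ℝ}
    (h : TypShellCond ρ β b n ε δ) :
    ∃ Typ : (Fin 4 → ℤ) → Set (LGConfig 4 G),
      (∀ c, MeasurableSet (Typ c)) ∧
      (∀ c, DependsOn (fun σ : LGConfig 4 G => σ ∈ Typ c) ↑(cellEdges (stdFrame b) c)) ∧
      ClauseI ρ β (stdFrame b) n ε Typ ∧
      (∀ S : ℕ, 4 * b ≤ 2 * S + 1 → ∀ c : Fin 4 → ℤ,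
        (∀ i, -(S : ℤ) ≤ stdFrame b i (c i) ∧ stdFrame b i (c i + 1) ≤ (S : ℤ) + 1) →
          (wilsonMeasure (d := 4) (L := 2 * S + 1) ρ β)
              {V : GaugeConfig 4 (2 * S + 1) G | torusLift (2 * S + 1) V ∉ Typ c} ≤ ENNReal.ofReal δ) := by
  obtain ⟨Typ, hmeas, hdep, hI, -, hIII⟩ := h (stdFrame b) (stdFrame_admissible b)
  refine ⟨Typ, hmeas, hdep, hI, fun S hS c hc => ?_⟩
  have h1 := hIII S hS {c} (Finset.singleton_nonempty c) (fun c' hc' => by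
    rw [Finset.mem_singleton] at hc'; subst hc'; exact hc)
  simpa using h1

end Format

/-! ## §3 Clause (i_T) at the slab region forces charged cell observables to be small (M) -/

section ColumnBound

variable {G : Type} [Group G] [TopologicalSpace G] [IsTopologicalGroup G] [CompactSpace G]
  [SecondCountableTopology G] [MeasurableSpace G] [BorelSpace G]
  {N : ℕ} (ρ : G →* Matrix (Fin N) (Fin N) ℂ)

/-- **(M) The twist row of the HEDGE format.**  If `Typ` satisfies (i_T) at the standard frame, then for `Y = rowCells n`
(admissible: `rowCells_subset`, `zero_mem_rowCells`), every datum `ζ` such that `ζ` AND `τ_k ζ` are typical on the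
cells of window+shell off the row, and every cell-0 cylinder `g`, `‖g‖ ≤ 1`, of charge `c ≠ 1` under `τ_k`
(`1 ≤ k ≤ b`):  `‖∫ g dγ_row(ζ)‖ ≤ 4ε/‖1 − c‖`.
Proof: the pair `(ζ, τ_k ζ)` agrees on the window cells off the row (`layerTwist_agree_off_row`), so (i_T) applies
to the four `[0,1]`-valued parts `(Re g)^±/‖·‖, (Im g)^±` (cylinder, measurable); §1 gives
`∫ g dγ(τ_k ζ) = c ∫ g dγ(ζ)`, hence `‖1−c‖·‖∫ g dγ(ζ)‖ ≤ 4ε`.  For GAUGE-INVARIANT `Typ` the typicality of `τ_k ζ` is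
that of `ζ` (`mem_layerTwist_iff`) — no data predicate that is a property of the gauge orbit removes this row. -/
theorem norm_integral_charged_le_of_clauseI (hρ : Continuous ρ) {β : ℝ} {b n : ℕ} {ε : ℝ}
    {Typ : (Fin 4 → ℤ) → Set (LGConfig 4 G)}
    (hI : ClauseI ρ β (stdFrame b) n ε Typ)
    {g₀ : G} (hg : g₀ ∈ Subgroup.center G) {k : ℤ} (hk : 1 ≤ k ∧ k ≤ (b : ℤ)) {c : ℂ} (hc : c ≠ 1)
    {g : LGConfig 4 G → ℂ} (hgm : Measurable g) (hgb : ∀ U, ‖g U‖ ≤ 1)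
    (hgcyl : IsCylinder g (cellEdges (stdFrame b) 0))
    (hcharged : ∀ U, g (layerTwist k g₀ U) = c * g U) (ζ : LGConfig 4 G)
    (hζ : ∀ c' ∈ windowCellsPlus n, c' ∉ rowCells n → ζ ∈ Typ c' ∧ layerTwist k g₀ ζ ∈ Typ c') :
    ‖∫ U, g U ∂(ymSpecification ρ β (rowRegion b n) ζ)‖ ≤ 4 * ε / ‖1 - c‖ := by
  classical
  set μ := ymSpecification ρ β (rowRegion b n) ζ with hμ
  set μ' := ymSpecification ρ β (rowRegion b n) (layerTwist k g₀ ζ) with hμ'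
  haveI : IsProbabilityMeasure μ := isProbabilityMeasure_ymSpecification ρ hρ β _ ζ
  haveI : IsProbabilityMeasure μ' := isProbabilityMeasure_ymSpecification ρ hρ β _ _
  -- clause (i_T) applied to the admissible, typical twist pair `(ζ, τ_k ζ)` at `Y = rowCells n`
  have hpair : ∀ f : LGConfig 4 G → ℝ, IsCylinder f (cellEdges (stdFrame b) 0) → Measurable f →
      (∀ U, 0 ≤ f U ∧ f U ≤ 1) → |(∫ U, f U ∂μ) - ∫ U, f U ∂μ'| ≤ ε := fun f hf hfm hf01 =>
    hI (rowCells n) (rowCells_subset n) (zero_mem_rowCells n) ζ (layerTwist k g₀ ζ) hζ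
      (layerTwist_agree_off_row hk g₀ ζ) f hf hfm hf01
  -- real tests `u` with `|u| ≤ 1`: shift to `(1 + u)/2 ∈ [0, 1]`
  have key : ∀ u : LGConfig 4 G → ℝ, IsCylinder u (cellEdges (stdFrame b) 0) → Measurable u →
      (∀ U, |u U| ≤ 1) → |(∫ U, u U ∂μ) - ∫ U, u U ∂μ'| ≤ 2 * ε := by
    intro u hu hum hub
    have hcyl : IsCylinder (fun U => (1 + u U) / 2) (cellEdges (stdFrame b) 0) := by
      intro x y hxy
      show (1 + u x) / 2 = (1 + u y) / 2
      rw [hu hxy]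
    have h01 : ∀ U, 0 ≤ (1 + u U) / 2 ∧ (1 + u U) / 2 ≤ 1 := fun U => by
      have := abs_le.1 (hub U)
      constructor <;> linarith [this.1, this.2]
    have h := hpair _ hcyl ((measurable_const.add hum).div_const 2) h01
    have hi : ∀ ν : Measure (LGConfig 4 G), IsProbabilityMeasure ν → Integrable u ν := fun ν _ =>
      (integrable_const (1 : ℝ)).mono' hum.aestronglyMeasurable
        (ae_of_all _ fun U => by simpa [Real.norm_eq_abs] using hub U)
    have hshift : ∀ ν : Measure (LGConfig 4 G), IsProbabilityMeasure ν →
        ∫ U, (1 + u U) / 2 ∂ν = (1 + ∫ U, u U ∂ν) / 2 := by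
      intro ν hν
      have h1 : ∫ U, (1 + u U) ∂ν = 1 + ∫ U, u U ∂ν := by
        rw [integral_add (integrable_const _) (hi ν hν)]
        simp
      simp_rw [div_eq_mul_inv]
      rw [integral_mul_const, h1]
    rw [hshift μ inferInstance, hshift μ' inferInstance] at h
    have : (1 + ∫ U, u U ∂μ) / 2 - (1 + ∫ U, u U ∂μ') / 2 = ((∫ U, u U ∂μ) - ∫ U, u U ∂μ') / 2 := by
      ring
    rw [this, abs_div, abs_two] at h
    linarith
  -- the real and imaginary parts of `g`
  have hRe := key (fun U => (g U).re) (fun x y hxy => by show (g x).re = (g y).re; rw [hgcyl hxy])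
    (Complex.measurable_re.comp hgm) (fun U => (Complex.abs_re_le_norm _).trans (hgb U))
  have hIm := key (fun U => (g U).im) (fun x y hxy => by show (g x).im = (g y).im; rw [hgcyl hxy])
    (Complex.measurable_im.comp hgm) (fun U => (Complex.abs_im_le_norm _).trans (hgb U))
  have hgi : ∀ ν : Measure (LGConfig 4 G), IsProbabilityMeasure ν → Integrable g ν := fun ν _ =>
    (integrable_const (1 : ℝ)).mono' hgm.aestronglyMeasurable (ae_of_all _ fun U => hgb U)
  have hre : ∀ ν : Measure (LGConfig 4 G), IsProbabilityMeasure ν →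
      ∫ U, (g U).re ∂ν = (∫ U, g U ∂ν).re := fun ν hν => by
    simpa using Complex.reCLM.integral_comp_comm (hgi ν hν)
  have him : ∀ ν : Measure (LGConfig 4 G), IsProbabilityMeasure ν →
      ∫ U, (g U).im ∂ν = (∫ U, g U ∂ν).im := fun ν hν => by
    simpa using Complex.imCLM.integral_comp_comm (hgi ν hν)
  rw [hre μ inferInstance, hre μ' inferInstance] at hRe
  rw [him μ inferInstance, him μ' inferInstance] at hIm
  -- the charged identity `∫ g dμ' = c ∫ g dμ`
  have hch : ∫ U, g U ∂μ' = c * ∫ U, g U ∂μ :=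
    integral_charged_layerTwist ρ hρ hg β k (rowRegion b n) ζ hgm hcharged
  set I := ∫ U, g U ∂μ with hIdef
  have hdiff : I - ∫ U, g U ∂μ' = (1 - c) * I := by rw [hch]; ring
  have hnorm : ‖(1 - c) * I‖ ≤ 4 * ε := by
    rw [← hdiff]
    refine (Complex.norm_le_abs_re_add_abs_im _).trans ?_
    rw [Complex.sub_re, Complex.sub_im]
    linarith
  have hc' : 0 < ‖1 - c‖ := norm_pos_iff.2 (sub_ne_zero.2 (Ne.symm hc))
  rw [le_div_iff₀ hc', mul_comm]
  simpa [norm_mul] using hnorm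

/-- **PROVED (S). Real, sharp form for ANTI-charged tests** (`u ∘ τ_k = −u`, e.g. a `ℤ₂` or centre-sign column):
clause (i_T) at the row with the single test `f = (1 + u)/2` gives `|∫ u dγ_row(ζ)| ≤ ε` — no constant lost. -/
theorem abs_integral_anticharged_le_of_clauseI (hρ : Continuous ρ) {β : ℝ} {b n : ℕ} {ε : ℝ}
    {Typ : (Fin 4 → ℤ) → Set (LGConfig 4 G)} (hI : ClauseI ρ β (stdFrame b) n ε Typ)
    {g₀ : G} (hg : g₀ ∈ Subgroup.center G) {k : ℤ} (hk : 1 ≤ k ∧ k ≤ (b : ℤ))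
    {u : LGConfig 4 G → ℝ} (hum : Measurable u) (hub : ∀ U, |u U| ≤ 1)
    (hucyl : IsCylinder u (cellEdges (stdFrame b) 0)) (hanti : ∀ U, u (layerTwist k g₀ U) = -u U)
    (ζ : LGConfig 4 G)
    (hζ : ∀ c' ∈ windowCellsPlus n, c' ∉ rowCells n → ζ ∈ Typ c' ∧ layerTwist k g₀ ζ ∈ Typ c') :
    |∫ U, u U ∂(ymSpecification ρ β (rowRegion b n) ζ)| ≤ ε := by
  classical
  set μ := ymSpecification ρ β (rowRegion b n) ζ with hμ
  set μ' := ymSpecification ρ β (rowRegion b n) (layerTwist k g₀ ζ) with hμ'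
  haveI : IsProbabilityMeasure μ := isProbabilityMeasure_ymSpecification ρ hρ β _ ζ
  haveI : IsProbabilityMeasure μ' := isProbabilityMeasure_ymSpecification ρ hρ β _ _
  have hcyl : IsCylinder (fun U => (1 + u U) / 2) (cellEdges (stdFrame b) 0) := by
    intro x y hxy
    show (1 + u x) / 2 = (1 + u y) / 2
    rw [hucyl hxy]
  have h01 : ∀ U, 0 ≤ (1 + u U) / 2 ∧ (1 + u U) / 2 ≤ 1 := fun U => by
    have := abs_le.1 (hub U)
    constructor <;> linarith [this.1, this.2]
  have h : |(∫ U, (1 + u U) / 2 ∂μ) - ∫ U, (1 + u U) / 2 ∂μ'| ≤ ε :=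
    hI (rowCells n) (rowCells_subset n) (zero_mem_rowCells n) ζ (layerTwist k g₀ ζ) hζ
      (layerTwist_agree_off_row hk g₀ ζ) _ hcyl ((measurable_const.add hum).div_const 2) h01
  have hi : ∀ ν : Measure (LGConfig 4 G), IsProbabilityMeasure ν → Integrable u ν := fun ν _ =>
    (integrable_const (1 : ℝ)).mono' hum.aestronglyMeasurable
      (ae_of_all _ fun U => by simpa [Real.norm_eq_abs] using hub U)
  have hshift : ∀ ν : Measure (LGConfig 4 G), IsProbabilityMeasure ν →
      ∫ U, (1 + u U) / 2 ∂ν = (1 + ∫ U, u U ∂ν) / 2 := by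
    intro ν hν
    have h1 : ∫ U, (1 + u U) ∂ν = 1 + ∫ U, u U ∂ν := by
      rw [integral_add (integrable_const _) (hi ν hν)]
      simp
    simp_rw [div_eq_mul_inv]
    rw [integral_mul_const, h1]
  -- the anti-charged identity `∫ u dμ' = -∫ u dμ`
  have hflip : ∫ U, u U ∂μ' = -∫ U, u U ∂μ := by
    rw [hμ', ← ymSpecification_map_layerTwist ρ hρ hg β k (rowRegion b n) ζ,
      integral_map (measurable_layerTwist k g₀).aemeasurable hum.aestronglyMeasurable]
    simp_rw [hanti]
    exact integral_neg _
  rw [hshift μ inferInstance, hshift μ' inferInstance, hflip] at h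
  have : (1 + ∫ U, u U ∂μ) / 2 - (1 + -∫ U, u U ∂μ) / 2 = ∫ U, u U ∂μ := by ring
  rwa [this] at h

end ColumnBound


/-! ## §4 (GEN 5) Fixed mesh, large `β`: clause (i_T) fails for every compact `G` with a charged centre element -/

section FixedMesh

open Literature.MathematicalPhysics.QuantumFieldTheory (wilsonMeasure GaugeConfig isProbabilityMeasure_wilsonMeasure
  measurable_torusLift gaugeTransform wilsonMeasure_map_gaugeTransform_holds wilsonAction)
open Summit.QuantumFields.YangMills.Theorems.TunedSequenceExists.Negative.Freezing (tendsto_integral_wilsonMeasure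
  re_trace_le_of_mem_unitaryGroup re_trace_eq_of_wilsonAction_eq_zero plaquetteHolonomyZd_torusLift')

variable {G : Type} [Group G] [TopologicalSpace G] [IsTopologicalGroup G] [CompactSpace G]
  [SecondCountableTopology G] [MeasurableSpace G] [BorelSpace G]
  {N : ℕ} (ρ : G →* Matrix (Fin N) (Fin N) ℂ)

/-! ### 4a. The column, the staple, the data-adapted charged test, the rectangle loop -/

/-- The site `(t, s, 0, 0)`. -/
def site2 (t s : ℤ) : Site 4 := fun i => if i = 0 then t else if i = 1 then s else 0

@[simp] theorem site2_zero (t s : ℤ) : site2 t s 0 = t := rfl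

@[simp] theorem site2_one (t s : ℤ) : site2 t s 1 = s := rfl

/-- The cell-0 COLUMN `U(e₁) · U(e₂) ⋯ U(e_b)`, `e_t = ((t,0,0,0), 0)`: the transport along the time line of cell `0`
of the standard frame from height `1` to height `b + 1` (the factor `e₁`, the one twisted by `τ_1`, separated). -/
def col (b : ℕ) (U : LGConfig 4 G) : G :=
  U (site2 1 0, 0) * ((List.range (b - 1)).map fun i : ℕ => U (site2 ((i : ℤ) + 2) 0, 0)).prod

/-- The STAPLE closing the column into the boundary of the rectangle `[0, b+1] × [0, m]` of the `(0,1)`-plane: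
top run at height `b + 1` (`m` links, forward), down run at `x₁ = m` (`b + 1` links, backward), bottom run at
height `0` (`m` links, backward), and the closing link `((0,0,0,0), 0)` (forward) back to the column's foot
`(1,0,0,0)`.  `col U * staple U` is the holonomy of the closed contractible lattice rectangle based at `(1,0,0,0)`. -/
def staple (b m : ℕ) (U : LGConfig 4 G) : G :=
  ((List.range m).map fun s : ℕ => U (site2 ((b : ℤ) + 1) s, 1)).prod *
    ((((List.range (b + 1)).reverse).map fun t : ℕ => (U (site2 t m, 0))⁻¹).prod *
      ((((List.range m).reverse).map fun s : ℕ => (U (site2 0 s, 1))⁻¹).prod * U (site2 0 0, 0)))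

/-- The DATA-ADAPTED CHARGED TEST: the column of `U` closed by the staple READ OFF THE DATUM `ζ` (a fixed group
element): `g_ζ(U) = tr ρ(col_b(U) · staple_{b,m}(ζ)) / N`. -/
def chargedTest (b m : ℕ) (ζ U : LGConfig 4 G) : ℂ := (ρ (col b U * staple b m ζ)).trace / N

/-- The rectangle WILSON LOOP observable `W(U) = Re tr ρ(col_b(U) · staple_{b,m}(U)) / N`. -/
def loopObs (b m : ℕ) (U : LGConfig 4 G) : ℝ := (chargedTest ρ b m U U).re

/-- Edges read by the column. -/
def colEdges (b : ℕ) : Finset (ZdEdge 4) :=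
  {(site2 1 0, (0 : Fin 4))} ∪ (Finset.range (b - 1)).image fun i : ℕ => (site2 ((i : ℤ) + 2) 0, (0 : Fin 4))

/-- Edges read by the staple. -/
def stapleEdges (b m : ℕ) : Finset (ZdEdge 4) :=
  ((Finset.range m).image fun s : ℕ => (site2 ((b : ℤ) + 1) s, (1 : Fin 4))) ∪
    ((Finset.range (b + 1)).image fun t : ℕ => (site2 t m, (0 : Fin 4))) ∪
      ((Finset.range m).image fun s : ℕ => (site2 0 s, (1 : Fin 4))) ∪ {(site2 0 0, (0 : Fin 4))}

/-- Edges read by the loop. -/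
def loopEdges (b m : ℕ) : Finset (ZdEdge 4) := colEdges b ∪ stapleEdges b m

/-! ### 4b. Algebra: congruence, charge, bounds, continuity (PROVED) -/

omit [TopologicalSpace G] [IsTopologicalGroup G] [CompactSpace G] [SecondCountableTopology G]
  [MeasurableSpace G] [BorelSpace G] in
theorem col_congr {b : ℕ} {U U' : LGConfig 4 G} (h : ∀ e ∈ colEdges b, U e = U' e) : col b U = col b U' := by
  unfold col
  have h1 : U (site2 1 0, 0) = U' (site2 1 0, 0) :=
    h _ (Finset.mem_union_left _ (Finset.mem_singleton_self _))
  have h2 : ((List.range (b - 1)).map fun i : ℕ => U (site2 ((i : ℤ) + 2) 0, 0)) =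
      (List.range (b - 1)).map fun i : ℕ => U' (site2 ((i : ℤ) + 2) 0, 0) := by
    refine List.map_congr_left fun i hi => h _ (Finset.mem_union_right _ ?_)
    exact Finset.mem_image.2 ⟨i, by simpa using hi, rfl⟩
  rw [h1, h2]

omit [TopologicalSpace G] [IsTopologicalGroup G] [CompactSpace G] [SecondCountableTopology G]
  [MeasurableSpace G] [BorelSpace G] in
theorem staple_congr {b m : ℕ} {U U' : LGConfig 4 G} (h : ∀ e ∈ stapleEdges b m, U e = U' e) :
    staple b m U = staple b m U' := by
  unfold staple
  have htop : ((List.range m).map fun s : ℕ => U (site2 ((b : ℤ) + 1) s, 1)) =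
      (List.range m).map fun s : ℕ => U' (site2 ((b : ℤ) + 1) s, 1) := by
    refine List.map_congr_left fun s hs => h _ ?_
    simp only [stapleEdges, Finset.mem_union, Finset.mem_image, Finset.mem_range, Finset.mem_singleton]
    exact Or.inl (Or.inl (Or.inl ⟨s, by simpa using hs, rfl⟩))
  have hdown : (((List.range (b + 1)).reverse).map fun t : ℕ => (U (site2 t m, 0))⁻¹) =
      ((List.range (b + 1)).reverse).map fun t : ℕ => (U' (site2 t m, 0))⁻¹ := by
    refine List.map_congr_left fun t ht => ?_
    rw [h _ ?_]
    simp only [stapleEdges, Finset.mem_union, Finset.mem_image, Finset.mem_range, Finset.mem_singleton]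
    exact Or.inl (Or.inl (Or.inr ⟨t, by simpa using ht, rfl⟩))
  have hbot : (((List.range m).reverse).map fun s : ℕ => (U (site2 0 s, 1))⁻¹) =
      ((List.range m).reverse).map fun s : ℕ => (U' (site2 0 s, 1))⁻¹ := by
    refine List.map_congr_left fun s hs => ?_
    rw [h _ ?_]
    simp only [stapleEdges, Finset.mem_union, Finset.mem_image, Finset.mem_range, Finset.mem_singleton]
    exact Or.inl (Or.inr ⟨s, by simpa using hs, rfl⟩)
  have hclose : U (site2 0 0, 0) = U' (site2 0 0, 0) := h _ (by simp [stapleEdges])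
  rw [htop, hdown, hbot, hclose]

omit [TopologicalSpace G] [IsTopologicalGroup G] [CompactSpace G] [SecondCountableTopology G]
  [MeasurableSpace G] [BorelSpace G] in
/-- **PROVED.** The loop observable is a cylinder on `loopEdges`. -/
theorem loopObs_isCylinder (b m : ℕ) : IsCylinder (loopObs ρ b m) (loopEdges b m) := by
  intro U U' hUU'
  have hc : col b U = col b U' :=
    col_congr fun e he => hUU' e (Finset.mem_coe.2 (Finset.mem_union_left _ he))
  have hs : staple b m U = staple b m U' :=
    staple_congr fun e he => hUU' e (Finset.mem_coe.2 (Finset.mem_union_right _ he))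
  simp only [loopObs, chargedTest, hc, hs]

omit [TopologicalSpace G] [IsTopologicalGroup G] [CompactSpace G] [SecondCountableTopology G]
  [MeasurableSpace G] [BorelSpace G] in
/-- **PROVED.** `τ_1` multiplies the column by the central `g₀`. -/
theorem col_layerTwist_one (g₀ : G) (b : ℕ) (U : LGConfig 4 G) :
    col b (layerTwist 1 g₀ U) = g₀ * col b U := by
  unfold col
  have h1 : layerTwist 1 g₀ U (site2 1 0, 0) = g₀ * U (site2 1 0, 0) := by
    simp [layerTwist, site2]
  have h2 : ((List.range (b - 1)).map fun i : ℕ => layerTwist 1 g₀ U (site2 ((i : ℤ) + 2) 0, 0)) =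
      (List.range (b - 1)).map fun i : ℕ => U (site2 ((i : ℤ) + 2) 0, 0) := by
    refine List.map_congr_left fun i _ => ?_
    have : ¬ ((i : ℤ) + 2 = 1) := by omega
    simp [layerTwist, site2, this]
  rw [h1, h2, mul_assoc]

omit [TopologicalSpace G] [IsTopologicalGroup G] [CompactSpace G] [SecondCountableTopology G]
  [MeasurableSpace G] [BorelSpace G] in
/-- **PROVED.** The data-adapted test has charge `c` under `τ_1` when `ρ g₀ = c • 1` (no centrality needed:
the twisted link is the FIRST factor of the column). -/
theorem chargedTest_layerTwist {g₀ : G} {c : ℂ}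
    (hρc : ρ g₀ = c • (1 : Matrix (Fin N) (Fin N) ℂ)) (b m : ℕ) (ζ U : LGConfig 4 G) :
    chargedTest ρ b m ζ (layerTwist 1 g₀ U) = c * chargedTest ρ b m ζ U := by
  unfold chargedTest
  rw [col_layerTwist_one g₀, mul_assoc, map_mul, hρc, smul_mul_assoc, one_mul, Matrix.trace_smul,
    smul_eq_mul, mul_div_assoc]

omit [TopologicalSpace G] [IsTopologicalGroup G] [CompactSpace G] [SecondCountableTopology G]
  [MeasurableSpace G] [BorelSpace G] in
theorem site2_mem_cellEdges_zero {b : ℕ} {t : ℤ} (ht : 1 ≤ t ∧ t ≤ (b : ℤ)) :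
    (site2 t 0, (0 : Fin 4)) ∈ cellEdges (stdFrame b) 0 := by
  refine Finset.mem_product.2 ⟨Fintype.mem_piFinset.2 fun i => ?_, Finset.mem_univ _⟩
  simp only [site2, stdFrame, Pi.zero_apply, Finset.mem_Ico, mul_zero, zero_add, mul_one]
  have h10 : (1 : Fin 4) ≠ 0 := by decide
  by_cases hi : i = 0
  · subst hi; simp; omega
  · by_cases hi1 : i = 1
    · subst hi1; simp [h10]; omega
    · simp [hi, hi1]; omega

omit [TopologicalSpace G] [IsTopologicalGroup G] [CompactSpace G] [SecondCountableTopology G]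
  [MeasurableSpace G] [BorelSpace G] in
theorem colEdges_subset_cellEdges {b : ℕ} (hb : 1 ≤ b) : colEdges b ⊆ cellEdges (stdFrame b) 0 := by
  intro e he
  rcases Finset.mem_union.1 he with he | he
  · rw [Finset.mem_singleton] at he
    subst he
    exact site2_mem_cellEdges_zero ⟨le_rfl, by exact_mod_cast hb⟩
  · obtain ⟨i, hi, rfl⟩ := Finset.mem_image.1 he
    rw [Finset.mem_range] at hi
    exact site2_mem_cellEdges_zero ⟨by omega, by omega⟩

omit [TopologicalSpace G] [IsTopologicalGroup G] [CompactSpace G] [SecondCountableTopology G]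
  [MeasurableSpace G] [BorelSpace G] in
/-- **PROVED.** The charged test is a cylinder on the centre cell's edges (for each fixed datum `ζ`). -/
theorem chargedTest_isCylinder {b : ℕ} (hb : 1 ≤ b) (m : ℕ) (ζ : LGConfig 4 G) :
    IsCylinder (chargedTest ρ b m ζ) (cellEdges (stdFrame b) 0) := by
  intro U U' hUU'
  have hc : col b U = col b U' :=
    col_congr fun e he => hUU' e (Finset.mem_coe.2 (colEdges_subset_cellEdges hb he))
  simp only [chargedTest, hc]

/-- `‖tr M‖ ≤ N` for unitary `M` (copy of the tree's `FiniteTemperature.norm_trace_le_of_mem_unitaryGroup`). -/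
theorem norm_trace_le_of_unitary {M : Matrix (Fin N) (Fin N) ℂ} (hM : M ∈ Matrix.unitaryGroup (Fin N) ℂ) :
    ‖M.trace‖ ≤ N := by
  calc ‖M.trace‖ = ‖∑ i, M i i‖ := by rw [Matrix.trace]; rfl
    _ ≤ ∑ i, ‖M i i‖ := norm_sum_le _ _
    _ ≤ ∑ _i : Fin N, (1 : ℝ) := Finset.sum_le_sum fun i _ => entry_norm_bound_of_unitary hM i i
    _ = N := by simp

omit [TopologicalSpace G] [IsTopologicalGroup G] [CompactSpace G] [SecondCountableTopology G]
  [MeasurableSpace G] [BorelSpace G] in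
theorem norm_trace_div_le (hρu : ∀ g, ρ g ∈ Matrix.unitaryGroup (Fin N) ℂ) (x : G) :
    ‖(ρ x).trace / (N : ℂ)‖ ≤ 1 := by
  have h := norm_trace_le_of_unitary (hρu x)
  rw [norm_div, Complex.norm_natCast]
  by_cases hN : (N : ℝ) = 0
  · rw [hN, div_zero]; exact zero_le_one
  · rwa [div_le_one (lt_of_le_of_ne (Nat.cast_nonneg N) (Ne.symm hN))]

omit [TopologicalSpace G] [IsTopologicalGroup G] [CompactSpace G] [SecondCountableTopology G]
  [MeasurableSpace G] [BorelSpace G] in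
/-- **PROVED.** `‖g_ζ(U)‖ ≤ 1`. -/
theorem norm_chargedTest_le (hρu : ∀ g, ρ g ∈ Matrix.unitaryGroup (Fin N) ℂ) (b m : ℕ)
    (ζ U : LGConfig 4 G) : ‖chargedTest ρ b m ζ U‖ ≤ 1 :=
  norm_trace_div_le ρ hρu _

omit [TopologicalSpace G] [IsTopologicalGroup G] [CompactSpace G] [SecondCountableTopology G]
  [MeasurableSpace G] [BorelSpace G] in
/-- **PROVED.** `|W(U)| ≤ 1`. -/
theorem abs_loopObs_le (hρu : ∀ g, ρ g ∈ Matrix.unitaryGroup (Fin N) ℂ) (b m : ℕ) (U : LGConfig 4 G) :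
    |loopObs ρ b m U| ≤ 1 :=
  (Complex.abs_re_le_norm _).trans (norm_chargedTest_le ρ hρu b m U U)

omit [CompactSpace G] [SecondCountableTopology G] [MeasurableSpace G] [BorelSpace G] in
theorem continuous_col (b : ℕ) : Continuous (col (G := G) b) := by
  unfold col
  exact (continuous_apply _).mul
    (continuous_list_prod (f := fun (i : ℕ) (U : LGConfig 4 G) => U (site2 ((i : ℤ) + 2) 0, 0)) _
      fun i _ => continuous_apply _)

omit [CompactSpace G] [SecondCountableTopology G] [MeasurableSpace G] [BorelSpace G] in
theorem continuous_staple (b m : ℕ) : Continuous (staple (G := G) b m) := by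
  unfold staple
  refine (continuous_list_prod (f := fun (s : ℕ) (U : LGConfig 4 G) => U (site2 ((b : ℤ) + 1) s, 1)) _
      fun s _ => continuous_apply _).mul ((continuous_list_prod
        (f := fun (t : ℕ) (U : LGConfig 4 G) => (U (site2 t m, 0))⁻¹) _
          fun t _ => (continuous_apply _).inv).mul ((continuous_list_prod
            (f := fun (s : ℕ) (U : LGConfig 4 G) => (U (site2 0 s, 1))⁻¹) _
              fun s _ => (continuous_apply _).inv).mul (continuous_apply _)))

omit [CompactSpace G] [SecondCountableTopology G] [MeasurableSpace G] [BorelSpace G] in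
theorem continuous_chargedTest (hρ : Continuous ρ) (b m : ℕ) (ζ : LGConfig 4 G) :
    Continuous (chargedTest ρ b m ζ) := by
  unfold chargedTest
  exact ((hρ.comp ((continuous_col b).mul continuous_const)).matrix_trace).div_const _

omit [CompactSpace G] [SecondCountableTopology G] [MeasurableSpace G] [BorelSpace G] in
theorem continuous_loopObs (hρ : Continuous ρ) (b m : ℕ) : Continuous (loopObs ρ b m) := by
  unfold loopObs chargedTest
  exact Complex.continuous_re.comp
    (((hρ.comp ((continuous_col b).mul (continuous_staple b m))).matrix_trace).div_const _)

omit [CompactSpace G] in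
theorem measurable_chargedTest (hρ : Continuous ρ) (b m : ℕ) (ζ : LGConfig 4 G) :
    Measurable (chargedTest ρ b m ζ) :=
  (continuous_chargedTest ρ hρ b m ζ).measurable

/-! ### 4c. Geometry of the row region: the staple is frozen, everything sits in the box (PROVED) -/

omit [TopologicalSpace G] [IsTopologicalGroup G] [CompactSpace G] [SecondCountableTopology G]
  [MeasurableSpace G] [BorelSpace G] in
/-- Coordinates of an edge of the row region: time coordinate in `[1, b]`, every coordinate in
`[-(2n+1)b, (2n+1)b - 1]` (time: `≤ b`). -/
theorem coords_of_mem_rowRegion {b n : ℕ} {e : ZdEdge 4} (he : e ∈ rowRegion b n) :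
    (1 ≤ e.1 0 ∧ e.1 0 ≤ (b : ℤ)) ∧
      ∀ i, -((2 * (n : ℤ) + 1) * b) ≤ e.1 i ∧ e.1 i + 1 ≤ (2 * (n : ℤ) + 1) * b + (if i = 0 then 1 else 0) := by
  unfold rowRegion regionEdges at he
  obtain ⟨y, hy, hey⟩ := Finset.mem_biUnion.1 he
  have hy0 : y 0 = 0 := (Finset.mem_filter.1 hy).2
  have hyw : y ∈ windowCells n := (Finset.mem_filter.1 hy).1
  have hyi : ∀ i, -(2 * (n : ℤ)) ≤ y i ∧ y i ≤ 2 * (n : ℤ) := fun i => by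
    have := Fintype.mem_piFinset.1 hyw i
    simpa [Finset.mem_Icc] using this
  have hei : ∀ i, stdFrame b i (y i) ≤ e.1 i ∧ e.1 i < stdFrame b i (y i + 1) := fun i =>
    Finset.mem_Ico.1 (Fintype.mem_piFinset.1 (Finset.mem_product.1 hey).1 i)
  have hb : (0 : ℤ) ≤ b := Int.natCast_nonneg b
  have hn : (0 : ℤ) ≤ n := Int.natCast_nonneg n
  refine ⟨?_, fun i => ?_⟩
  · have h0 := hei 0
    simp only [stdFrame, if_true, hy0] at h0
    constructor <;> linarith
  · have h := hei i
    have h1 := mul_le_mul_of_nonneg_left (hyi i).1 hb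
    have h2 := mul_le_mul_of_nonneg_left (hyi i).2 hb
    by_cases hi : i = 0
    · subst hi
      simp only [stdFrame, if_true, hy0] at h
      simp only [if_true]
      constructor <;> nlinarith
    · simp only [stdFrame, if_neg hi] at h
      simp only [if_neg hi]
      constructor <;> nlinarith

omit [TopologicalSpace G] [IsTopologicalGroup G] [CompactSpace G] [SecondCountableTopology G]
  [MeasurableSpace G] [BorelSpace G] in
/-- **PROVED.** With `m = (2n+1)b` no staple edge is resampled by the row kernel. -/
theorem stapleEdges_disjoint_rowRegion {b n m : ℕ} (hm : (m : ℤ) = (2 * (n : ℤ) + 1) * b) :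
    ∀ e ∈ stapleEdges b m, e ∉ rowRegion b n := by
  intro e he hrow
  have hc := coords_of_mem_rowRegion hrow
  simp only [stapleEdges, Finset.mem_union, Finset.mem_image, Finset.mem_range, Finset.mem_singleton] at he
  rcases he with ((⟨s, _, rfl⟩ | ⟨t, _, rfl⟩) | ⟨s, _, rfl⟩) | rfl
  · have h := hc.1.2
    simp only [site2_zero] at h
    omega
  · have h := (hc.2 1).2
    simp only [site2_one, (show (1 : Fin 4) ≠ 0 by decide), if_false, add_zero] at h
    -- `h : ↑m + 1 ≤ (2n+1) b`
    linarith
  · have h := hc.1.1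
    simp only [site2_zero] at h
    omega
  · have h := hc.1.1
    simp only [site2_zero] at h
    omega

omit [TopologicalSpace G] [IsTopologicalGroup G] [CompactSpace G] [SecondCountableTopology G]
  [MeasurableSpace G] [BorelSpace G] in
/-- **PROVED.** The staple reads only frozen links: it is the same for every configuration gluing `ζ` off the row. -/
theorem staple_eq_of_eq_off_row {b n m : ℕ} (hm : (m : ℤ) = (2 * (n : ℤ) + 1) * b) {U ζ : LGConfig 4 G}
    (h : ∀ e, e ∉ rowRegion b n → U e = ζ e) : staple b m U = staple b m ζ :=
  staple_congr fun e he => h e (stapleEdges_disjoint_rowRegion hm e he)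

omit [TopologicalSpace G] [IsTopologicalGroup G] [CompactSpace G] [SecondCountableTopology G]
  [MeasurableSpace G] [BorelSpace G] in
/-- **PROVED.** The row region with its plaquette collar is based in `box 4 S`, `S = (2n+2)b + 1`. -/
theorem rowRegion_collar_mem_box (b n : ℕ) :
    ∀ e ∈ rowRegion b n ∪ (plaquettesTouching (rowRegion b n)).biUnion plaquetteEdges,
      e.1 ∈ box 4 ((2 * n + 2) * b + 1) := by
  intro e he
  have hb : (0 : ℤ) ≤ b := Int.natCast_nonneg b
  have hn : (0 : ℤ) ≤ n := Int.natCast_nonneg n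
  rw [mem_box]
  intro k
  push_cast
  rcases Finset.mem_union.1 he with he | he
  · have h := (coords_of_mem_rowRegion he).2 k
    have : (if k = 0 then (1 : ℤ) else 0) ≤ 1 := by split_ifs <;> norm_num
    constructor <;> nlinarith
  · obtain ⟨e', he', hn'⟩ := exists_near_of_mem_collar he
    have h := (coords_of_mem_rowRegion he').2 k
    have hk := hn' k
    have : (if k = 0 then (1 : ℤ) else 0) ≤ 1 := by split_ifs <;> norm_num
    constructor <;> nlinarith

omit [TopologicalSpace G] [IsTopologicalGroup G] [CompactSpace G] [SecondCountableTopology G]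
  [MeasurableSpace G] [BorelSpace G] in
/-- **PROVED.** The loop is based in `box 4 S`. -/
theorem loopEdges_mem_box {b n m : ℕ} (hm : (m : ℤ) = (2 * (n : ℤ) + 1) * b) :
    ∀ e ∈ loopEdges b m, e.1 ∈ box 4 ((2 * n + 2) * b + 1) := by
  intro e he
  have hb : (0 : ℤ) ≤ b := Int.natCast_nonneg b
  have hn : (0 : ℤ) ≤ n := Int.natCast_nonneg n
  have hnb : (0 : ℤ) ≤ (n : ℤ) * b := mul_nonneg hn hb
  -- every loop site is `site2 t s` with `0 ≤ t ≤ b + 1`, `0 ≤ s ≤ m`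
  have key : ∀ t s : ℤ, 0 ≤ t → t ≤ (b : ℤ) + 1 → 0 ≤ s → s ≤ (m : ℤ) →
      site2 t s ∈ box 4 ((2 * n + 2) * b + 1) := by
    intro t s ht0 ht1 hs0 hs1
    rw [mem_box]
    intro k
    push_cast
    simp only [site2]
    split_ifs <;> constructor <;> nlinarith
  have hm0 : (0 : ℤ) ≤ (m : ℤ) := Int.natCast_nonneg m
  simp only [loopEdges, colEdges, stapleEdges, Finset.mem_union, Finset.mem_image, Finset.mem_range,
    Finset.mem_singleton] at he
  rcases he with (rfl | ⟨i, hi, rfl⟩) | (((⟨s, hs, rfl⟩ | ⟨t, ht, rfl⟩) | ⟨s, hs, rfl⟩) | rfl)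
  · exact key 1 0 (by norm_num) (by linarith) le_rfl hm0
  · have hi' : (i : ℤ) + 2 ≤ (b : ℤ) := by omega
    exact key _ 0 (by positivity) (by linarith) le_rfl hm0
  · have hs' : (s : ℤ) < (m : ℤ) := by exact_mod_cast hs
    exact key _ _ (by positivity) le_rfl (Int.natCast_nonneg s) hs'.le
  · have ht' : (t : ℤ) < (b : ℤ) + 1 := by exact_mod_cast ht
    exact key _ _ (Int.natCast_nonneg t) ht'.le hm0 le_rfl
  · have hs' : (s : ℤ) < (m : ℤ) := by exact_mod_cast hs
    exact key 0 _ le_rfl (by linarith) (Int.natCast_nonneg s) hs'.le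
  · exact key 0 0 le_rfl (by linarith) le_rfl hm0

/-! ### 4d. Properness and the torus DLR equation (PROVED) -/

/-- **PROVED (properness).** Under the row kernel with datum `ζ` the loop IS the data-adapted charged test of `ζ`:
`∫ W dγ_row(ζ) = ∫ Re g_ζ dγ_row(ζ)` (the staple is glued to `ζ`; tree `integral_ymSpecification`, `glueWith`). -/
theorem integral_loopObs_eq (hρ : Continuous ρ) (β : ℝ) {b n m : ℕ} (hm : (m : ℤ) = (2 * (n : ℤ) + 1) * b)
    (ζ : LGConfig 4 G) :
    ∫ U, loopObs ρ b m U ∂(ymSpecification ρ β (rowRegion b n) ζ) =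
      ∫ U, (chargedTest ρ b m ζ U).re ∂(ymSpecification ρ β (rowRegion b n) ζ) := by
  rw [integral_ymSpecification ρ hρ β _ (continuous_loopObs ρ hρ b m).measurable,
    integral_ymSpecification ρ hρ β _ (F := fun U => (chargedTest ρ b m ζ U).re)
      (Complex.measurable_re.comp (measurable_chargedTest ρ hρ b m ζ))]
  congr 1
  refine integral_congr_ae (ae_of_all _ fun ζ' => ?_)
  have hst : staple b m (glueWith (rowRegion b n) ζ' ζ) = staple b m ζ :=
    staple_eq_of_eq_off_row hm fun e he => glueWith_apply_not_mem _ _ _ he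
  simp only [loopObs, chargedTest, hst]

/-- **PROVED (torus DLR, instance of the tree's `integral_torusLift_eq_integral_ymSpecification`).** -/
theorem integral_loopObs_torus (hρ : Continuous ρ) (hρu : ∀ g, ρ g ∈ Matrix.unitaryGroup (Fin N) ℂ)
    (β : ℝ) {b n m : ℕ} (hm : (m : ℤ) = (2 * (n : ℤ) + 1) * b) :
    ∫ V, loopObs ρ b m (torusLift (2 * ((2 * n + 2) * b + 1) + 1) V)
        ∂(wilsonMeasure (d := 4) (L := 2 * ((2 * n + 2) * b + 1) + 1) ρ β) =
      ∫ V, (∫ U, loopObs ρ b m U ∂(ymSpecification ρ β (rowRegion b n)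
          (torusLift (2 * ((2 * n + 2) * b + 1) + 1) V)))
        ∂(wilsonMeasure (d := 4) (L := 2 * ((2 * n + 2) * b + 1) + 1) ρ β) :=
  integral_torusLift_eq_integral_ymSpecification ρ hρ β (rowRegion b n) (continuous_loopObs ρ hρ b m)
    (abs_loopObs_le ρ hρu b m) (loopObs_isCylinder ρ b m) (rowRegion_collar_mem_box b n)
    (loopEdges_mem_box hm)

/-! ### 4e. The pointwise bound at a twisted typical pair (PROVED, from §3) -/

/-- **PROVED.** If `Typ` satisfies clause (i_T) at the standard frame and the datum `ζ` is typical TOGETHER WITH its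
twist `τ_1 ζ` on the window+shell cells off the row, then the row kernel's mean of the LOOP is `≤ 4ε/‖1−c‖`. -/
theorem integral_loopObs_le_of_clauseI (hρ : Continuous ρ) (hρu : ∀ g, ρ g ∈ Matrix.unitaryGroup (Fin N) ℂ)
    {β : ℝ} {b n m : ℕ} (hb : 1 ≤ b) (hm : (m : ℤ) = (2 * (n : ℤ) + 1) * b) {ε : ℝ}
    {Typ : (Fin 4 → ℤ) → Set (LGConfig 4 G)} (hI : ClauseI ρ β (stdFrame b) n ε Typ)
    {g₀ : G} (hg : g₀ ∈ Subgroup.center G) {c : ℂ} (hρc : ρ g₀ = c • (1 : Matrix (Fin N) (Fin N) ℂ))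
    (hc : c ≠ 1) (ζ : LGConfig 4 G)
    (hζ : ∀ c' ∈ windowCellsPlus n, c' ∉ rowCells n → ζ ∈ Typ c' ∧ layerTwist 1 g₀ ζ ∈ Typ c') :
    ∫ U, loopObs ρ b m U ∂(ymSpecification ρ β (rowRegion b n) ζ) ≤ 4 * ε / ‖1 - c‖ := by
  rw [integral_loopObs_eq ρ hρ β hm ζ]
  haveI : IsProbabilityMeasure (ymSpecification ρ β (rowRegion b n) ζ) :=
    isProbabilityMeasure_ymSpecification ρ hρ β _ ζ
  have hgi : Integrable (chargedTest ρ b m ζ) (ymSpecification ρ β (rowRegion b n) ζ) :=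
    (integrable_const (1 : ℝ)).mono' (measurable_chargedTest ρ hρ b m ζ).aestronglyMeasurable
      (ae_of_all _ fun U => norm_chargedTest_le ρ hρu b m ζ U)
  have hre : ∫ U, (chargedTest ρ b m ζ U).re ∂(ymSpecification ρ β (rowRegion b n) ζ) =
      (∫ U, chargedTest ρ b m ζ U ∂(ymSpecification ρ β (rowRegion b n) ζ)).re := by
    simpa using Complex.reCLM.integral_comp_comm hgi
  rw [hre]
  have hk : (1 : ℤ) ≤ 1 ∧ (1 : ℤ) ≤ (b : ℤ) := ⟨le_rfl, by exact_mod_cast hb⟩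
  exact (Complex.re_le_norm _).trans
    (norm_integral_charged_le_of_clauseI ρ hρ hI hg hk hc (measurable_chargedTest ρ hρ b m ζ)
      (norm_chargedTest_le ρ hρu b m ζ) (chargedTest_isCylinder ρ hb m ζ)
      (chargedTest_layerTwist ρ hρc b m ζ) ζ hζ)

/-! ### 4f. The two named inputs S1, S2 (both PROVED; stub names kept for the card's references) -/

/-- **STUB S1 — twisted typical pairs are abundant (union bound + torus gauge invariance; M).**
For a measurable CELL-LOCAL class `Typ` whose single-cell atypicality has torus probability `≤ δ` on every cell of
window+shell (the format's anchor (iii_T) at `F = {c}`), the data `V` for which BOTH `torusLift V` and its twist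
`τ_1 (torusLift V)` are typical on all window+shell cells off the row have mass `≥ 1 − 2·#cells·δ`.
Proof sketch: the first kind of failure has mass `≤ δ` per cell by hypothesis; for the second,
`τ_1 = gaugeTransformZd (slabGauge 1 g₀)` (§0) agrees on every edge with an endpoint in `box 4 S` with
`gaugeTransformZd (ĝ ∘ Torus.proj)`, `ĝ := slabGauge 1 g₀ ∘ Torus.cRep` (tree `Torus.cRep_proj_of_mem_box`), and
`torusLift (gaugeTransform ĝ V) = gaugeTransformZd (ĝ ∘ proj) (torusLift V)` (tree
`WilsonBlockHeatBath.torusLift_gaugeTransform`); the cells of window+shell are based in `box 4 ((2n+2)b)` so by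
cell-locality (`hdep`) `{τ_1 lift V ∉ Typ c} = (gaugeTransform ĝ)⁻¹ {lift V ∉ Typ c}`, of the same mass by
`wilsonMeasure_map_gaugeTransform_holds`; finish with the union bound over `windowCellsPlus n`. -/
theorem cellEdges_endpoints_mem_box {b n S : ℕ} (hS : (2 * n + 2) * b + 1 ≤ S) {c : Fin 4 → ℤ}
    (hc : c ∈ windowCellsPlus n) {e : ZdEdge 4} (he : e ∈ cellEdges (stdFrame b) c) :
    e.1 ∈ box 4 S ∧ e.1 + Pi.single e.2 1 ∈ box 4 S := by
  have hci : ∀ i, -(2 * (n : ℤ) + 1) ≤ c i ∧ c i ≤ 2 * (n : ℤ) + 1 := fun i => by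
    have := Fintype.mem_piFinset.1 hc i
    simpa [Finset.mem_Icc] using this
  have hei : ∀ i, stdFrame b i (c i) ≤ e.1 i ∧ e.1 i < stdFrame b i (c i + 1) := fun i =>
    Finset.mem_Ico.1 (Fintype.mem_piFinset.1 (Finset.mem_product.1 he).1 i)
  have hb : (0 : ℤ) ≤ b := Int.natCast_nonneg b
  have hS' : (2 * (n : ℤ) + 2) * b + 1 ≤ (S : ℤ) := by exact_mod_cast hS
  have hcoord : ∀ i, -(S : ℤ) ≤ e.1 i ∧ e.1 i + 1 ≤ (S : ℤ) := by
    intro i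
    have h := hei i
    have h1 := mul_le_mul_of_nonneg_left (hci i).1 hb
    have h2 := mul_le_mul_of_nonneg_left (hci i).2 hb
    by_cases hi : i = 0
    · subst hi
      simp only [stdFrame, if_true] at h
      constructor <;> nlinarith
    · simp only [stdFrame, if_neg hi] at h
      constructor <;> nlinarith
  rw [mem_box, mem_box]
  refine ⟨fun i => ⟨(hcoord i).1, by linarith [(hcoord i).2]⟩, fun i => ?_⟩
  rw [Pi.add_apply, Pi.single_apply]
  split_ifs <;> constructor <;> linarith [(hcoord i).1, (hcoord i).2]

omit [SecondCountableTopology G] in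
/-- **S1 — twisted typical pairs are abundant (PROVED; union bound + torus gauge invariance).**
For a measurable CELL-LOCAL class `Typ` whose single-cell atypicality has torus probability `≤ δ` on every cell of
window+shell (the format's anchor (iii_T) at `F = {c}`), the data `V` for which BOTH `torusLift V` and its twist
`τ_1 (torusLift V)` are typical on all window+shell cells have mass `≥ 1 − 2·#cells·δ`.
Proof: the first kind of failure has mass `≤ δ` per cell by hypothesis; for the second,
`τ_1 = gaugeTransformZd (slabGauge 1 g₀)` (§0) agrees on every edge with both endpoints in `box 4 S` with
`gaugeTransformZd (ĝ ∘ Torus.proj)`, `ĝ := slabGauge 1 g₀ ∘ Torus.cRep` (tree `Torus.cRep_proj_of_mem_box`), and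
`torusLift (gaugeTransform ĝ V) = gaugeTransformZd (ĝ ∘ proj) (torusLift V)` (tree
`WilsonBlockHeatBath.torusLift_gaugeTransform`); the cells of window+shell are based in `box 4 S` so by
cell-locality (`hdep`) `{τ_1 lift V ∉ Typ c} = (gaugeTransform ĝ)⁻¹ {lift V ∉ Typ c}`, of the same mass by
`wilsonMeasure_map_gaugeTransform_holds`; finish with the union bound over `windowCellsPlus n`. -/
theorem stub_twistedTypicalPairs (β : ℝ) {b n S : ℕ}
    (hS : (2 * n + 2) * b + 1 ≤ S) (Typ : (Fin 4 → ℤ) → Set (LGConfig 4 G))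
    (hmeas : ∀ c, MeasurableSet (Typ c))
    (hdep : ∀ c, DependsOn (fun σ : LGConfig 4 G => σ ∈ Typ c) ↑(cellEdges (stdFrame b) c)) {δ : ℝ}
    (hδ : 0 ≤ δ)
    (hanch : ∀ c ∈ windowCellsPlus n,
      (wilsonMeasure (d := 4) (L := 2 * S + 1) ρ β)
          {V : GaugeConfig 4 (2 * S + 1) G | torusLift (2 * S + 1) V ∉ Typ c} ≤ ENNReal.ofReal δ)
    {g₀ : G} (hg : g₀ ∈ Subgroup.center G) :
    ∃ B : Set (GaugeConfig 4 (2 * S + 1) G), MeasurableSet B ∧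
      (wilsonMeasure (d := 4) (L := 2 * S + 1) ρ β) B ≤
        ENNReal.ofReal (2 * ((windowCellsPlus n).card : ℝ) * δ) ∧
      ∀ V ∉ B, ∀ c ∈ windowCellsPlus n, c ∉ rowCells n →
        torusLift (2 * S + 1) V ∈ Typ c ∧ layerTwist 1 g₀ (torusLift (2 * S + 1) V) ∈ Typ c := by
  classical
  set L : ℕ := 2 * S + 1 with hL
  set μ := wilsonMeasure (d := 4) (L := L) ρ β with hμ
  -- the two kinds of bad events
  set A : (Fin 4 → ℤ) → Set (GaugeConfig 4 L G) := fun c => {V | torusLift L V ∉ Typ c} with hA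
  set T : (Fin 4 → ℤ) → Set (GaugeConfig 4 L G) :=
    fun c => {V | layerTwist 1 g₀ (torusLift L V) ∉ Typ c} with hT
  have hAm : ∀ c, MeasurableSet (A c) := fun c =>
    (hmeas c).compl.preimage (measurable_torusLift L)
  have hTm : ∀ c, MeasurableSet (T c) := fun c =>
    (hmeas c).compl.preimage ((measurable_layerTwist 1 g₀).comp (measurable_torusLift L))
  have hanchA : ∀ c ∈ windowCellsPlus n, μ (A c) ≤ ENNReal.ofReal δ := hanch
  -- the torus gauge `ĝ = slabGauge 1 g₀ ∘ cRep` implements `τ_1` on every window+shell cell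
  have hkey : ∀ c ∈ windowCellsPlus n,
      T c = gaugeTransform (fun x => slabGauge 1 g₀ (Torus.cRep x)) ⁻¹' A c := by
    intro c hc
    ext V
    simp only [hT, hA, Set.mem_setOf_eq, Set.mem_preimage, not_iff_not]
    have hagree : ∀ e ∈ (↑(cellEdges (stdFrame b) c) : Set (ZdEdge 4)),
        layerTwist 1 g₀ (torusLift L V) e =
          torusLift L (gaugeTransform (fun x => slabGauge 1 g₀ (Torus.cRep x)) V) e := by
      intro e he
      have hbox := cellEdges_endpoints_mem_box hS hc (Finset.mem_coe.1 he)
      rw [layerTwist_eq_gaugeTransformZd hg, WilsonBlockHeatBath.torusLift_gaugeTransform]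
      simp only [gaugeTransformZd, Function.comp_apply]
      rw [Torus.cRep_proj_of_mem_box (by omega) hbox.1, Torus.cRep_proj_of_mem_box (by omega) hbox.2]
    exact Iff.of_eq (hdep c hagree)
  have hμT : ∀ c ∈ windowCellsPlus n, μ (T c) ≤ ENNReal.ofReal δ := by
    intro c hc
    have hmap : μ.map (gaugeTransform (fun x => slabGauge 1 g₀ (Torus.cRep x))) = μ :=
      wilsonMeasure_map_gaugeTransform_holds (d := 4) (L := L) ρ β _
    rw [hkey c hc, ← Measure.map_apply (WilsonBlockHeatBath.measurable_gaugeTransform _) (hAm c), hmap]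
    exact hanchA c hc
  -- the bad set: union bound
  refine ⟨⋃ c ∈ windowCellsPlus n, (A c ∪ T c), ?_, ?_, ?_⟩
  · exact Finset.measurableSet_biUnion _ fun c _ => (hAm c).union (hTm c)
  · calc μ (⋃ c ∈ windowCellsPlus n, (A c ∪ T c))
          ≤ ∑ c ∈ windowCellsPlus n, μ (A c ∪ T c) := measure_biUnion_finset_le _ _
      _ ≤ ∑ c ∈ windowCellsPlus n, (ENNReal.ofReal δ + ENNReal.ofReal δ) :=
          Finset.sum_le_sum fun c hc =>
            (measure_union_le _ _).trans (add_le_add (hanchA c hc) (hμT c hc))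
      _ = ENNReal.ofReal (2 * ((windowCellsPlus n).card : ℝ) * δ) := by
          rw [Finset.sum_const, nsmul_eq_mul, ← ENNReal.ofReal_add hδ hδ, ← ENNReal.ofReal_natCast,
            ← ENNReal.ofReal_mul (Nat.cast_nonneg _)]
          congr 1
          ring
  · intro V hV c hc _
    simp only [Set.mem_iUnion, Set.mem_union, not_exists, not_or] at hV
    have h := hV c hc
    refine ⟨of_not_not fun h1 => h.1 ?_, of_not_not fun h2 => h.2 ?_⟩
    · exact h1
    · exact h2

/-! ### 4f⁺. Fixed-torus freezing — S2 PROVED (GEN 5 continuation): planar lattice Stokes + tree Laplace lemma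

Zero Wilson action ⇒ every torus plaquette holonomy has `Re tr ρ = N` (tree
`Freezing.re_trace_eq_of_wilsonAction_eq_zero`) ⇒ `ρ(U_p) = 1` (unitary rigidity, below) ⇒ `U_p = 1` (`ρ` faithful)
⇒ the periodic lift is `(0,1)`-flat (tree `Freezing.plaquetteHolonomyZd_torusLift'`) ⇒ the rectangle loop
`col · staple = 1` (planar lattice Stokes: two inductions on transports, pure group algebra) ⇒ `W ∘ lift = 1` on the
zero set; the tree's Laplace concentration `Freezing.tendsto_integral_wilsonMeasure` (fixed torus, `β → ∞`,
continuous observable constant on the zero set of the action) gives `E_β[W ∘ lift] → 1`. -/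

/-- `Re tr M = N` for a unitary `N × N` matrix forces `M = 1` (row `i` is a unit vector and `Re M_ii ≤ |M_ii| ≤ 1`
with sum `N`).  Copied from tree `Literature.Barriers.QuantumFields.eq_one_of_re_trace_eq`
(DiscreteSubgroupFreezing; Barriers are not imported into this sketch). [folklore] -/
theorem eq_one_of_re_trace_eq' {M : Matrix (Fin N) (Fin N) ℂ} (hU : M ∈ Matrix.unitaryGroup (Fin N) ℂ)
    (htr : M.trace.re = N) : M = 1 := by
  have hW := Matrix.mem_unitaryGroup_iff.1 hU
  have hrow2 : ∀ i, ∑ j, ‖M i j‖ ^ 2 = 1 := by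
    intro i
    have h1 : ∑ j, M i j * star (M i j) = 1 := by
      have := congrFun (congrFun hW i) i
      simpa [Matrix.mul_apply, Matrix.star_apply, Matrix.one_apply] using this
    have : ∀ j, M i j * star (M i j) = ((‖M i j‖ ^ 2 : ℝ) : ℂ) := by
      intro j
      rw [Complex.star_def, Complex.mul_conj, Complex.normSq_eq_norm_sq]
    simp_rw [this] at h1
    exact_mod_cast h1
  have hdiag_le : ∀ i, ‖M i i‖ ≤ 1 := by
    intro i
    have h3 : ‖M i i‖ ^ 2 ≤ 1 := by
      rw [← hrow2 i]
      exact Finset.single_le_sum (f := fun j => ‖M i j‖ ^ 2) (fun j _ => by positivity) (Finset.mem_univ i)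
    nlinarith [norm_nonneg (M i i)]
  have hre : ∀ i, (M i i).re = 1 := by
    have hsum : ∑ i, (M i i).re = N := by
      have : M.trace.re = ∑ i, (M i i).re := by rw [Matrix.trace]; simp [Complex.re_sum]
      rw [← this, htr]
    have hle : ∀ i ∈ (Finset.univ : Finset (Fin N)), (M i i).re ≤ 1 :=
      fun i _ => (Complex.re_le_norm _).trans (hdiag_le i)
    by_contra hcon
    push Not at hcon
    obtain ⟨i, hi⟩ := hcon
    have hlt : (M i i).re < 1 := lt_of_le_of_ne (hle i (Finset.mem_univ i)) hi
    have : ∑ i, (M i i).re < ∑ _i : Fin N, (1 : ℝ) := Finset.sum_lt_sum hle ⟨i, Finset.mem_univ i, hlt⟩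
    simp at this
    linarith
  have hdiag : ∀ i, M i i = 1 := by
    intro i
    have h1 : ‖M i i‖ = 1 := le_antisymm (hdiag_le i) (by
      have := Complex.re_le_norm (M i i); rw [hre i] at this; exact this)
    have him : (M i i).im = 0 := by
      have hsq : (M i i).re ^ 2 + (M i i).im ^ 2 = ‖M i i‖ ^ 2 := by
        rw [← Complex.normSq_eq_norm_sq, Complex.normSq_apply]; ring
      rw [hre i, h1] at hsq
      nlinarith
    exact Complex.ext (by simp [hre i]) (by simp [him])
  have hoff : ∀ i j, j ≠ i → M i j = 0 := by
    intro i j hji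
    have h := hrow2 i
    rw [← Finset.add_sum_erase _ _ (Finset.mem_univ i), hdiag i, norm_one, one_pow] at h
    have hzero : ∑ x ∈ Finset.univ.erase i, ‖M i x‖ ^ 2 = 0 := by linarith
    have := (Finset.sum_eq_zero_iff_of_nonneg (fun x _ => by positivity)).1 hzero j
      (Finset.mem_erase.2 ⟨hji, Finset.mem_univ j⟩)
    simpa using this
  ext i j
  by_cases h : i = j
  · subst h; rw [hdiag i, Matrix.one_apply_eq]
  · rw [hoff i j (Ne.symm h), Matrix.one_apply_ne h]

/-- Straight transport `(0,s) → (A,s)` in direction `0` (the links at heights `0, …, A-1` of the line `x₁ = s`). -/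
def upT (U : LGConfig 4 G) (s : ℤ) (A : ℕ) : G :=
  ((List.range A).map fun t : ℕ => U (site2 (t : ℤ) s, 0)).prod

/-- Straight transport `(t,0) → (t,M)` in direction `1` (the links `x₁ = 0, …, M-1` of the line at height `t`). -/
def rightT (U : LGConfig 4 G) (t : ℤ) (M : ℕ) : G :=
  ((List.range M).map fun s : ℕ => U (site2 t (s : ℤ), 1)).prod

omit [TopologicalSpace G] [IsTopologicalGroup G] [CompactSpace G] [SecondCountableTopology G]
  [MeasurableSpace G] [BorelSpace G] in
@[simp] theorem upT_zero (U : LGConfig 4 G) (s : ℤ) : upT U s 0 = 1 := by simp [upT]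

omit [TopologicalSpace G] [IsTopologicalGroup G] [CompactSpace G] [SecondCountableTopology G]
  [MeasurableSpace G] [BorelSpace G] in
@[simp] theorem rightT_zero (U : LGConfig 4 G) (t : ℤ) : rightT U t 0 = 1 := by simp [rightT]

omit [TopologicalSpace G] [IsTopologicalGroup G] [CompactSpace G] [SecondCountableTopology G]
  [MeasurableSpace G] [BorelSpace G] in
theorem upT_succ (U : LGConfig 4 G) (s : ℤ) (A : ℕ) :
    upT U s (A + 1) = upT U s A * U (site2 (A : ℤ) s, 0) := by
  simp [upT, List.range_succ]

omit [TopologicalSpace G] [IsTopologicalGroup G] [CompactSpace G] [SecondCountableTopology G]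
  [MeasurableSpace G] [BorelSpace G] in
theorem rightT_succ (U : LGConfig 4 G) (t : ℤ) (M : ℕ) :
    rightT U t (M + 1) = rightT U t M * U (site2 t (M : ℤ), 1) := by
  simp [rightT, List.range_succ]

theorem site2_add_single_zero (t s : ℤ) : site2 t s + Pi.single (0 : Fin 4) 1 = site2 (t + 1) s := by
  funext k
  fin_cases k <;> simp [site2]

theorem site2_add_single_one (t s : ℤ) : site2 t s + Pi.single (1 : Fin 4) 1 = site2 t (s + 1) := by
  funext k
  fin_cases k <;> simp [site2]

/-- `(0,1)`-flatness of a `ℤ⁴` configuration on the coordinate plane through the origin: every plaquette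
holonomy `U_{(t,s;0,1)} = 1`. -/
def Flat01 (U : LGConfig 4 G) : Prop := ∀ t s : ℤ, plaquetteHolonomyZd U (site2 t s) 0 1 = 1

omit [TopologicalSpace G] [IsTopologicalGroup G] [CompactSpace G] [SecondCountableTopology G]
  [MeasurableSpace G] [BorelSpace G] in
theorem Flat01.link {U : LGConfig 4 G} (hU : Flat01 U) (t s : ℤ) :
    U (site2 (t + 1) s, 1) = (U (site2 t s, 0))⁻¹ * U (site2 t s, 1) * U (site2 t (s + 1), 0) := by
  have hf := hU t s
  rw [plaquetteHolonomyZd, site2_add_single_zero, site2_add_single_one] at hf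
  calc U (site2 (t + 1) s, 1)
      = (U (site2 t s, 0))⁻¹ * (U (site2 t s, 0) * U (site2 (t + 1) s, 1) * (U (site2 t (s + 1), 0))⁻¹ *
          (U (site2 t s, 1))⁻¹) * U (site2 t s, 1) * U (site2 t (s + 1), 0) := by group
    _ = _ := by rw [hf]; group

omit [TopologicalSpace G] [IsTopologicalGroup G] [CompactSpace G] [SecondCountableTopology G]
  [MeasurableSpace G] [BorelSpace G] in
/-- Stokes for a one-plaquette-high strip `[0,A] × [M,M+1]` (induction on `A`). -/
theorem strip_eq_one {U : LGConfig 4 G} (hU : Flat01 U) (M : ℕ) : ∀ A : ℕ,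
    upT U M A * U (site2 (A : ℤ) M, 1) * (upT U ((M : ℤ) + 1) A)⁻¹ * (U (site2 0 (M : ℤ), 1))⁻¹ = 1 := by
  intro A
  induction A with
  | zero => simp
  | succ A ih =>
    rw [upT_succ, upT_succ]
    push_cast
    have h1 := hU.link (A : ℤ) (M : ℤ)
    have h2 : upT U (M : ℤ) A =
        U (site2 0 (M : ℤ), 1) * upT U ((M : ℤ) + 1) A * (U (site2 (A : ℤ) (M : ℤ), 1))⁻¹ := by
      calc upT U (M : ℤ) A
          = (upT U M A * U (site2 (A : ℤ) M, 1) * (upT U ((M : ℤ) + 1) A)⁻¹ * (U (site2 0 (M : ℤ), 1))⁻¹) *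
              (U (site2 0 (M : ℤ), 1) * upT U ((M : ℤ) + 1) A * (U (site2 (A : ℤ) (M : ℤ), 1))⁻¹) := by group
        _ = _ := by rw [ih]; group
    rw [h1, h2]
    group

omit [TopologicalSpace G] [IsTopologicalGroup G] [CompactSpace G] [SecondCountableTopology G]
  [MeasurableSpace G] [BorelSpace G] in
/-- **Planar lattice Stokes**: on a `(0,1)`-flat configuration the boundary holonomy of the rectangle
`[0,A] × [0,M]` based at the origin is trivial (induction on `M`, strips glued along the left column). -/
theorem rect_eq_one {U : LGConfig 4 G} (hU : Flat01 U) (A : ℕ) : ∀ M : ℕ,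
    upT U 0 A * rightT U (A : ℤ) M * (upT U (M : ℤ) A)⁻¹ * (rightT U 0 M)⁻¹ = 1 := by
  intro M
  induction M with
  | zero => simp
  | succ M ih =>
    rw [rightT_succ, rightT_succ]
    push_cast
    have hs := strip_eq_one hU M A
    have h1 : (upT U ((M : ℤ) + 1) A)⁻¹ =
        (U (site2 (A : ℤ) (M : ℤ), 1))⁻¹ * (upT U (M : ℤ) A)⁻¹ * U (site2 0 (M : ℤ), 1) := by
      calc (upT U ((M : ℤ) + 1) A)⁻¹
          = (U (site2 (A : ℤ) (M : ℤ), 1))⁻¹ * (upT U (M : ℤ) A)⁻¹ *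
              (upT U M A * U (site2 (A : ℤ) M, 1) * (upT U ((M : ℤ) + 1) A)⁻¹ * (U (site2 0 (M : ℤ), 1))⁻¹) *
              U (site2 0 (M : ℤ), 1) := by group
        _ = _ := by rw [hs]; group
    have h2 : upT U 0 A = rightT U 0 M * upT U (M : ℤ) A * (rightT U (A : ℤ) M)⁻¹ := by
      calc upT U 0 A = (upT U 0 A * rightT U (A : ℤ) M * (upT U (M : ℤ) A)⁻¹ * (rightT U 0 M)⁻¹) *
            (rightT U 0 M * upT U (M : ℤ) A * (rightT U (A : ℤ) M)⁻¹) := by group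
        _ = _ := by rw [ih]; group
    rw [h1, h2]
    group

omit [TopologicalSpace G] [IsTopologicalGroup G] [CompactSpace G] [SecondCountableTopology G]
  [MeasurableSpace G] [BorelSpace G] in
/-- The closing link times the column is the straight transport `(0,0) → (b+1,0)`. -/
theorem mul_col_eq_upT {b : ℕ} (hb : 1 ≤ b) (U : LGConfig 4 G) :
    U (site2 0 0, 0) * col b U = upT U 0 (b + 1) := by
  obtain ⟨b', rfl⟩ : ∃ b', b = b' + 1 := ⟨b - 1, by omega⟩
  simp only [col, upT, Nat.add_sub_cancel, List.range_succ_eq_map, List.map_cons, List.map_map,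
    List.prod_cons, Function.comp_def, Nat.succ_eq_add_one]
  push_cast
  simp only [add_assoc, one_add_one_eq_two]

omit [TopologicalSpace G] [IsTopologicalGroup G] [CompactSpace G] [SecondCountableTopology G]
  [MeasurableSpace G] [BorelSpace G] in
/-- The staple in transport form: top run, reversed right column, reversed bottom run, closing link. -/
theorem staple_eq_transport (b m : ℕ) (U : LGConfig 4 G) :
    staple b m U =
      rightT U ((b : ℤ) + 1) m * ((upT U (m : ℤ) (b + 1))⁻¹ * ((rightT U 0 m)⁻¹ * U (site2 0 0, 0))) := by
  simp only [staple, rightT, upT, List.prod_inv_reverse, List.map_map, List.map_reverse, Function.comp_def]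

omit [TopologicalSpace G] [IsTopologicalGroup G] [CompactSpace G] [SecondCountableTopology G]
  [MeasurableSpace G] [BorelSpace G] in
/-- **The rectangle loop is trivial on `(0,1)`-flat configurations** (`b ≥ 1`). -/
theorem col_mul_staple_eq_one {U : LGConfig 4 G} (hU : Flat01 U) {b : ℕ} (hb : 1 ≤ b) (m : ℕ) :
    col b U * staple b m U = 1 := by
  have hrect := rect_eq_one hU (b + 1) m
  push_cast at hrect
  rw [← mul_col_eq_upT hb U] at hrect
  rw [staple_eq_transport]
  have hcol : col b U = (U (site2 0 0, 0))⁻¹ *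
      (rightT U 0 m * upT U (m : ℤ) (b + 1) * (rightT U ((b : ℤ) + 1) m)⁻¹) := by
    calc col b U = (U (site2 0 0, 0))⁻¹ * (U (site2 0 0, 0) * col b U * rightT U ((b : ℤ) + 1) m *
          (upT U (m : ℤ) (b + 1))⁻¹ * (rightT U 0 m)⁻¹) *
          (rightT U 0 m * upT U (m : ℤ) (b + 1) * (rightT U ((b : ℤ) + 1) m)⁻¹) := by group
      _ = _ := by rw [hrect]; group
  rw [hcol]
  group

omit [TopologicalSpace G] [IsTopologicalGroup G] [CompactSpace G] [SecondCountableTopology G]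
  [MeasurableSpace G] [BorelSpace G] in
/-- **Zero action ⇒ the lifted rectangle loop is `1`.**  `S_W(V) = 0` ⇒ every torus plaquette has
`Re tr ρ(U_p) = N` ⇒ `ρ(U_p) = 1` ⇒ `U_p = 1` (`ρ` faithful) ⇒ the periodic lift is `(0,1)`-flat ⇒ Stokes. -/
theorem loopObs_torusLift_eq_one {L : ℕ} [NeZero L] (hρu : ∀ g, ρ g ∈ Matrix.unitaryGroup (Fin N) ℂ)
    (hρi : Function.Injective ρ) (hN : 1 ≤ N) {b : ℕ} (hb : 1 ≤ b) (m : ℕ) {V : GaugeConfig 4 L G}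
    (h0 : wilsonAction ρ V = 0) : loopObs ρ b m (torusLift L V) = 1 := by
  have hflat : Flat01 (torusLift L V) := by
    intro t s
    rw [plaquetteHolonomyZd_torusLift']
    have htr := re_trace_eq_of_wilsonAction_eq_zero ρ (fun g => re_trace_le_of_mem_unitaryGroup (hρu g)) h0
      (Torus.proj L (site2 t s)) 0 1 (by decide)
    exact hρi (by rw [eq_one_of_re_trace_eq' (hρu _) htr, map_one])
  have h1 := col_mul_staple_eq_one hflat hb m
  have hN' : (N : ℂ) ≠ 0 := by exact_mod_cast (show N ≠ 0 by omega)
  simp [loopObs, chargedTest, h1, Matrix.trace_one, hN']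

/-- **S2 — fixed-torus freezing of the contractible rectangle loop (PROVED).**
On ONE torus of side `2S+1`, the Wilson state concentrates as `β → ∞` on the zero set of the Wilson action
(tree `Freezing.tendsto_integral_wilsonMeasure`: Laplace concentration for a continuous observable constant on the
zero set, via compactness and Haar open-positivity), where the lifted rectangle loop equals `1`
(`loopObs_torusLift_eq_one`).  Hence `E_β[W ∘ lift] → 1`, in particular `≥ θ` for every `θ < 1` and all large `β`. -/
theorem stub_torusLoopFreezing (hρ : Continuous ρ) (hρi : Function.Injective ρ)
    (hρu : ∀ g, ρ g ∈ Matrix.unitaryGroup (Fin N) ℂ) (hN : 1 ≤ N) {b : ℕ} (hb : 1 ≤ b) (m S : ℕ)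
    {θ : ℝ} (hθ : θ < 1) :
    ∃ β₀ : ℝ, ∀ β : ℝ, β₀ ≤ β →
      θ ≤ ∫ V, loopObs ρ b m (torusLift (2 * S + 1) V) ∂(wilsonMeasure (d := 4) (L := 2 * S + 1) ρ β) := by
  have hρN : ∀ g, (ρ g).trace.re ≤ N := fun g => re_trace_le_of_mem_unitaryGroup (hρu g)
  have hF : Continuous fun V : GaugeConfig 4 (2 * S + 1) G => loopObs ρ b m (torusLift (2 * S + 1) V) :=
    (continuous_loopObs ρ hρ b m).comp (continuous_torusLift _)
  have hlim := tendsto_integral_wilsonMeasure ρ hρ hρN hF (c := 1)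
    (fun V hV => loopObs_torusLift_eq_one ρ hρu hρi hN hb m hV)
  obtain ⟨β₀, hβ₀⟩ := Filter.eventually_atTop.1 (hlim.eventually (eventually_gt_nhds hθ))
  exact ⟨β₀, fun β hβ => (hβ₀ β hβ).le⟩

/-! ### 4g. The composition (PROVED from S1, S2) -/

omit [TopologicalSpace G] [IsTopologicalGroup G] [CompactSpace G] [SecondCountableTopology G]
  [MeasurableSpace G] [BorelSpace G] in
/-- Frame bounds: every window+shell cell of the standard frame sits in the fundamental domain `[-S, S]⁴`,
`S = (2n+2)b + 1`. -/
theorem stdFrame_windowCellsPlus_bounds {b n : ℕ} {c : Fin 4 → ℤ} (hc : c ∈ windowCellsPlus n) :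
    ∀ i, -(((2 * n + 2) * b + 1 : ℕ) : ℤ) ≤ stdFrame b i (c i) ∧
      stdFrame b i (c i + 1) ≤ (((2 * n + 2) * b + 1 : ℕ) : ℤ) + 1 := by
  intro i
  have hci : -(2 * (n : ℤ) + 1) ≤ c i ∧ c i ≤ 2 * (n : ℤ) + 1 := by
    have := Fintype.mem_piFinset.1 hc i
    simpa [Finset.mem_Icc] using this
  have hb : (0 : ℤ) ≤ b := Int.natCast_nonneg b
  have h1 := mul_le_mul_of_nonneg_left hci.1 hb
  have h2 := mul_le_mul_of_nonneg_left hci.2 hb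
  push_cast
  simp only [stdFrame]
  split_ifs <;> constructor <;> nlinarith

/-- **THE FIXED-MESH NEGATIVE (PROVED from S1, S2).**  For every compact `G`, every continuous faithful unitary matrix
representation `ρ` of positive degree carrying a central element `g₀` as a scalar `c ≠ 1`, every mesh `b ≥ 1`, window
parameter `n`, mixing budget `0 ≤ ε < ‖1−c‖/16` and rarity budget `0 ≤ δ < 1/(4·#windowCellsPlus n)`:
format T FAILS at `(ρ, β, b, n, ε, δ)` for all sufficiently large `β`.  (So under (F1) the typical onset
`mixOnsetT ρ β n ε δ → ∞`: sanity∕calibration for `stub_onsetT`, not a refutation of `OnsetMixingTypical`.) -/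
theorem not_typShellCond_fixedMesh (hρ : Continuous ρ) (hρi : Function.Injective ρ)
    (hρu : ∀ g, ρ g ∈ Matrix.unitaryGroup (Fin N) ℂ) (hN : 1 ≤ N)
    {g₀ : G} (hg : g₀ ∈ Subgroup.center G) {c : ℂ} (hρc : ρ g₀ = c • (1 : Matrix (Fin N) (Fin N) ℂ))
    (hc : c ≠ 1) {b : ℕ} (hb : 1 ≤ b) (n : ℕ) {ε δ : ℝ} (hε0 : 0 ≤ ε) (hε : 16 * ε < ‖1 - c‖)
    (hδ0 : 0 ≤ δ) (hδ : 4 * ((windowCellsPlus n).card : ℝ) * δ < 1) :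
    ∃ β₀ : ℝ, ∀ β : ℝ, β₀ ≤ β → ¬ TypShellCond ρ β b n ε δ := by
  -- the torus half-side `S = (2n+2)b + 1` and the rectangle width `m = (2n+1)b`
  have hm : (((2 * n + 1) * b : ℕ) : ℤ) = (2 * (n : ℤ) + 1) * b := by push_cast; ring
  obtain ⟨β₀, hβ₀⟩ := stub_torusLoopFreezing ρ hρ hρi hρu hN hb ((2 * n + 1) * b) ((2 * n + 2) * b + 1)
    (θ := 3 / 4) (by norm_num)
  refine ⟨β₀, fun β hβ hT => ?_⟩
  -- notation
  set L : ℕ := 2 * ((2 * n + 2) * b + 1) + 1 with hL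
  set μ := wilsonMeasure (d := 4) (L := L) ρ β with hμ
  haveI : IsProbabilityMeasure μ := isProbabilityMeasure_wilsonMeasure ρ hρ β
  set Λ := rowRegion b n with hΛ
  set F : LGConfig 4 G → ℝ := loopObs ρ b ((2 * n + 1) * b) with hF
  set Ψ : GaugeConfig 4 L G → ℝ := fun V => ∫ U, F U ∂(ymSpecification ρ β Λ (torusLift L V)) with hΨ
  -- the format at the standard frame: a class `Typ` with (i_T) and the single-cell torus anchor
  obtain ⟨Typ, hmeas, hdep, hI, hanch⟩ := clauseI_of_typShellCond hT
  have hanch' : ∀ c' ∈ windowCellsPlus n,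
      μ {V : GaugeConfig 4 L G | torusLift L V ∉ Typ c'} ≤ ENNReal.ofReal δ := fun c' hc' =>
    hanch ((2 * n + 2) * b + 1) (by nlinarith) c' (stdFrame_windowCellsPlus_bounds hc')
  -- S1: the bad set
  obtain ⟨B, hBm, hμB, hgood⟩ :=
    stub_twistedTypicalPairs ρ β le_rfl Typ hmeas hdep hδ0 hanch' hg
  -- S2: freezing
  have hfreeze : (3 : ℝ) / 4 ≤ ∫ V, F (torusLift L V) ∂μ := hβ₀ β hβ
  -- torus DLR
  have hDLR : ∫ V, F (torusLift L V) ∂μ = ∫ V, Ψ V ∂μ := integral_loopObs_torus ρ hρ hρu β hm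
  -- pointwise: `Ψ ≤ 4ε/‖1−c‖` on the good set, `≤ 1` everywhere
  have hc' : 0 < ‖1 - c‖ := norm_pos_iff.2 (sub_ne_zero.2 (Ne.symm hc))
  have hq0 : 0 ≤ 4 * ε / ‖1 - c‖ := div_nonneg (by linarith) hc'.le
  have hΨ1 : ∀ V, |Ψ V| ≤ 1 := fun V =>
    abs_integral_ymSpecification_le ρ hρ β Λ (abs_loopObs_le ρ hρu b _) _
  have hptw : ∀ V, Ψ V ≤ 4 * ε / ‖1 - c‖ + B.indicator (1 : GaugeConfig 4 L G → ℝ) V := by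
    intro V
    by_cases hV : V ∈ B
    · rw [Set.indicator_of_mem hV, Pi.one_apply]
      linarith [(abs_le.1 (hΨ1 V)).2]
    · rw [Set.indicator_of_notMem hV, add_zero]
      exact integral_loopObs_le_of_clauseI ρ hρ hρu hb hm hI hg hρc hc _ (hgood V hV)
  -- integrate
  have hΨm : Measurable Ψ :=
    ((continuous_integral_ymSpecification ρ hρ β Λ (continuous_loopObs ρ hρ b _)
      (abs_loopObs_le ρ hρu b _)).comp (continuous_torusLift L)).measurable
  have hΨi : Integrable Ψ μ :=
    (integrable_const (1 : ℝ)).mono' hΨm.aestronglyMeasurable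
      (ae_of_all _ fun V => by simpa [Real.norm_eq_abs] using hΨ1 V)
  have hBi1 : Integrable (B.indicator (1 : GaugeConfig 4 L G → ℝ)) μ :=
    (integrable_const (1 : ℝ)).indicator hBm
  have hBi : Integrable (fun V => 4 * ε / ‖1 - c‖ + B.indicator (1 : GaugeConfig 4 L G → ℝ) V) μ :=
    (integrable_const _).add hBi1
  have hint : ∫ V, Ψ V ∂μ ≤ 4 * ε / ‖1 - c‖ + μ.real B := by
    calc ∫ V, Ψ V ∂μ ≤ ∫ V, (4 * ε / ‖1 - c‖ + B.indicator (1 : GaugeConfig 4 L G → ℝ) V) ∂μ :=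
          integral_mono hΨi hBi hptw
      _ = 4 * ε / ‖1 - c‖ + μ.real B := by
          rw [integral_add (integrable_const _) hBi1, integral_const, integral_indicator_one hBm]
          simp [Measure.real]
  have hμB' : μ.real B ≤ 2 * ((windowCellsPlus n).card : ℝ) * δ :=
    ENNReal.toReal_le_of_le_ofReal (by positivity) hμB
  have hq : 4 * ε / ‖1 - c‖ < 1 / 4 := by
    rw [div_lt_iff₀ hc']
    linarith
  linarith

end FixedMesh

end Summit.QuantumFields.YangMills.Cruxes.IR.CruxIdea8g5

end
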